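import Literature.Analysis.FluidPDE.PineauVicolLerayPressure
import Literature.Analysis.FluidPDE.PineauVicolRDSSLargeAlpha
import Literature.Analysis.FluidPDE.TsaiLocalPressureSup
import HarnessLib

/-!
# Pointwise decay of the Calderón–Zygmund pressure and its gradient on the Type I decay class (Pineau–Vicol 2026, Lemma 2.1 (2.2), (8.3))

Analysis/FluidPDE support file (all results proved; no definitions, no named facts), sequel of
`PineauVicolPressureDecayClass` / `PineauVicolPressureDuality` / `PineauVicolLerayPressure` in the
programme around `Literature.Analysis.FluidPDE.pineauVicol2026_rdss_liouville` (B. Pineau, V. Vicol,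
arXiv:2607.09619 (2026)). HONEST FRAMING: a transcription, with proof, of one printed estimate for a
class of hypothetical profiles; nothing here bears on Navier–Stokes regularity.

Lemma 2.1 of the source records, for profiles `U ∈ C²(ℝ³)` obeying the Type I decay
`|U(y)| ≤ C_{U,0}/(1+|y|)` (1.9) and `|∇U(y)| ≤ C_{U,1}/(1+|y|²)`, `|∇²U(y)| ≤ C_{U,2}/(1+|y|³)` (2.1),
the pressure bound (2.2): "for any `σ ∈ (0,1)`, there exists an `α`-independent constant
`C_{P,0} = C_{P,0}(C_{U,0}, σ) > 0` such that `|P(y)| ≤ C_{P,0}/(1+|y|^{2−σ})` for all `y ∈ ℝ³`",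
where `P = RᵢRⱼ(UⁱUʲ)` (p. 9); the proof (p. 10) is one sentence: "The bound (2.2) follows from the
singular integral kernel representation of `P = RᵢRⱼ(UⁱUʲ)`, and the previously established bounds
for `U` and `∇U`." In the tree `RᵢRⱼ(vᵢvⱼ)` on the (infinite-energy) decay class is the pressure
potential `Q[v] = pressurePotential v = −Γ₀ * ∂ᵢ∂ⱼ(vᵢvⱼ) − D²Γ∞ * (v ⊗ v)`
(`PressureRepresentation`, `PineauVicolPressureDecayClass`; `ΔQ[v] = −∂ᵢ∂ⱼ(vᵢvⱼ)`), and this file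
proves (2.2) for it **with `σ = 0`**, Calderón–Zygmund-free:

* `exists_bound_abs_pressurePotential_decay`: an absolute `A` with
  `|Q[v](x)| ≤ A (C₂C₀ + C₁² + C₀²)/(1+|x|)²` for `v ∈ C²` with `(1+|y|)|v| ≤ C₀`,
  `(1+|y|)²‖Dv‖ ≤ C₁`, `(1+|y|)³‖D²v‖ ≤ C₂`; `exists_bound_abs_pressurePotential_decay'`: the same in
  the printed shape `C₁/(1+|y|²)`, `C₂/(1+|y|³)`, `C_P/(1+|y|^s)` with the real exponent `s = 2`.
  Route: the Navier–Stokes dilation covariance `Q[λv(λ·)](e) = λ²Q[v](λe)` (tree,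
  `pressurePotential_smul_comp_smul`) with `λ = |x|`, `e = x/|x|` — the rescaling
  `ũ = r u(y + r·)` of the source's proof of (2.1) — reduces the bound at `x` to `|x|⁻²` times a
  bound at a unit vector for the dilated field `w = λv(λ·)`, whose weighted constants
  `|y||w| ≤ C₀`, `|y|²‖Dw‖ ≤ C₁`, `|y|³‖D²w‖ ≤ C₂` are scale-free
  (`norm_smul_comp_smul_mul_norm_le`, `norm_fderiv_smul_comp_smul_mul_norm_sq_le`,
  `norm_fderiv2_smul_comp_smul_mul_norm_cube_le`); at the unit vector the cutoff scale `(1/4,1/2)`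
  (`pressurePotential_eq_scale_decay`) splits `Q[w](e)` into the near part — `Γ₀ ∈ L¹` against the
  source bound `|∂ᵢ∂ⱼ(wᵢwⱼ)| ≤ 2T‖D²w‖|w| + (T+T²)‖Dw‖²` (`abs_pressureSource_le`) on `|e−z| ≥ 1/2`
  (`exists_bound_nearPotential_unitScale`) — and the far part — the kernel `‖D²Γ∞‖ ≤ M(1+|z|)⁻³`
  against the weight `C₀²|y|⁻²`, integrable near the origin in dimension three and `≤ 8(1+|y|)⁻⁵`
  times `M C₀²` for `|y| ≥ 2` (`exists_bound_farPotential_unitScale`); `|x| ≤ 1` is the uniform bound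
  `exists_bound_abs_pressurePotential_of_decay` (cutoff `(1,2)`, far part by the tree's
  `exists_bound_farPotential_scale_decay`). The sharp exponent `2` costs the second-derivative
  constant `C_{U,2}` of (2.1), which the printed `σ`-lossy statement does not use.
* `pineauVicol_prop_8_3''`: **Proposition 8.3 (8.6) on a slice for the Calderón–Zygmund pressure of
  the slice, with hypotheses on the profile only** — the tree's `pineauVicol_prop_8_3'`
  (`PineauVicolRDSSLargeAlpha`) with `P := Q[U]`, its pressure-decay hypothesis discharged by the
  above and its Poisson equation by `laplacian_pressurePotential_decay`; assumed remain (1.9), (2.1)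
  (`U ∈ C⁴`, divergence free) and Lemma 8.1's slice-source bound (8.2) on `F = ∂ₛU`;
  `pineauVicol_prop_6_5_exists''`: likewise **Proposition 6.5 (6.20) (RSS, `∃ A_ε ≥ 1` as printed) for
  `P := Q[U]` with hypotheses on the profile only** (the tree's `pineauVicol_prop_6_5_exists'`).
* `exists_bound_norm_fderiv_pressurePotential_decay` (section `GradientDecay`): the **pressure
  GRADIENT**, `‖∇Q[v](x)‖ ≤ A C² (1+|x|)⁻³` for `v ∈ C^∞` with `(1+|y|)^{j+1}‖Dʲv(y)‖ ≤ C`, `j ≤ 3` —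
  the `k = 1` case of the printed `|∇ᵏP| ≤ C_{P,k}/(1+|y|)^{2−σ+k}` ((8.3)), again with `σ = 0`, by the
  same dilation one derivative up (`∇(Q[λv(λ·)])(e) = λ³(∇Q[v])(λe)`): near part `Γ₀ ∈ L¹` against a
  pointwise Leibniz bound for `∇∂ᵢ∂ⱼ(wᵢwⱼ)` on `|e − z| ≥ 1/2`
  (`exists_bound_fderiv_nearPotential_unitScale`; this is where `D³v` enters), far part the kernel
  `D³Γ∞` against `C²|y|⁻²` (`exists_bound_fderiv_farPotential_unitScale`, `exists_dominator_unitScale`),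
  `|x| ≤ 1` by the tree's `exists_bound_fderiv_pressurePotential`
  (`exists_bound_fderiv_pressurePotential_of_decay`).

## References

* B. Pineau, V. Vicol, *On rotated backwards self-similar solutions of the incompressible
  Navier–Stokes equations*, arXiv:2607.09619 (2026): Lemma 2.1, (2.1)–(2.2) (p. 9), proof
  (p. 9–10); Proposition 6.5 (6.20) (p. 22); Lemma 8.1 (8.2)–(8.3) and Proposition 8.3 (8.6)
  (p. 28). [PineauVicol2026]
* D. Gilbarg, N. S. Trudinger, *Elliptic Partial Differential Equations of Second Order*
  (2001 reprint), Lemma 4.2 (the Newtonian potential of the source). [GilbargTrudinger2001]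
-/

noncomputable section

open MeasureTheory Set Filter Metric Topology InnerProductSpace Function
open scoped RealInnerProductSpace Laplacian ContDiff ENNReal

namespace Literature.Analysis.FluidPDE

namespace PineauVicol2026

open Literature.Analysis.FluidPDE.FourierNS (HasDecay)

-- nested operator types `ℝ³ →L[ℝ] ℝ³ →L[ℝ] ℝ`
set_option maxSynthPendingDepth 3

/-! ### The weight `|y|⁻²` near the origin -/

/-- `|y|⁻²` is integrable on balls of `ℝ³` (`2 < 3 = dim`). [folklore] -/
private theorem integrableOn_inv_norm_sq_ball (r : ℝ) :
    IntegrableOn (fun y : (EuclideanSpace ℝ (Fin 3)) => (‖y‖ ^ 2)⁻¹) (ball 0 r) := by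
  have hd : Module.finrank ℝ (EuclideanSpace ℝ (Fin 3)) = 3 := finrank_euclideanSpace_fin
  refine integrableOn_ball_of_norm_le_rpow (μ := volume) (C := 1) (α := 2) (by rw [hd]; norm_num)
    (by rw [hd]; norm_num) (Eventually.of_forall fun y => le_of_eq ?_) ?_
  · rw [Real.rpow_neg (norm_nonneg y), Real.rpow_two, norm_inv, norm_pow, norm_norm, one_mul]
  · exact ((continuous_norm.pow 2).measurable.inv).aestronglyMeasurable

/-! ### The far potential at unit scale against the weight `|y|⁻²` -/

/-- **Far part, unit scale.** There is an absolute `K` such that for every field `w` with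
`|y| |w(y)| ≤ C₀` and every `|e| ≤ 1`,
`|Q₂^{1/4,1/2}[w](e)| = |∫ D²Γ∞(e − y)(w y, w y) dy| ≤ K C₀²`: the kernel is bounded by
`M (1+|e−y|)⁻³`, the weight by `C₀² |y|⁻²`, and `|y|⁻²` is integrable near the origin while
`(1+|e−y|)⁻³ |y|⁻² ≤ 8 (1+|y|)⁻⁵` for `|y| ≥ 2` (the far half of the kernel-representation
estimate behind (2.2)). [cite: PineauVicol2026, Lemma 2.1, proof of (2.2) (p. 10)] -/
theorem exists_bound_farPotential_unitScale :
    ∃ K : ℝ, 0 ≤ K ∧ ∀ (w : (EuclideanSpace ℝ (Fin 3)) → (EuclideanSpace ℝ (Fin 3))) (C₀ : ℝ), (∀ y, ‖w y‖ * ‖y‖ ≤ C₀) →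
      ∀ e : (EuclideanSpace ℝ (Fin 3)), ‖e‖ ≤ 1 → |farPotential (4⁻¹ * 1) (4⁻¹ * 2) w e| ≤ K * C₀ ^ 2 := by
  have h₀ : (0 : ℝ) < 4⁻¹ * 1 := by norm_num
  have h₁ : (4⁻¹ * 1 : ℝ) < 4⁻¹ * 2 := by norm_num
  obtain ⟨⟨M, hM⟩, -, -⟩ := exists_hasDecay_fderiv_newtonFar h₀ h₁
  rw [hasDecay_iff_div] at hM
  have hM0 : 0 ≤ M := by
    have h := (norm_nonneg _).trans (hM 0)
    rw [norm_zero, add_zero, one_pow, div_one] at h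
    exact h
  set I₂ : ℝ := ∫ y in ball (0 : (EuclideanSpace ℝ (Fin 3))) 2, (‖y‖ ^ 2)⁻¹ with hI₂
  set K₅ : ℝ := ∫ y : (EuclideanSpace ℝ (Fin 3)), ((1 + ‖y‖) ^ 5)⁻¹ with hK₅
  have hI₂0 : 0 ≤ I₂ := integral_nonneg fun y => by positivity
  have hK₅0 : 0 ≤ K₅ := integral_nonneg fun y => by positivity
  refine ⟨M * (I₂ + 8 * K₅), by positivity, ?_⟩
  intro w C₀ hw e he
  have hC0 : 0 ≤ C₀ := by simpa using hw 0
  -- the dominator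
  set g : (EuclideanSpace ℝ (Fin 3)) → ℝ := fun y =>
    M * C₀ ^ 2 * ((ball (0 : (EuclideanSpace ℝ (Fin 3))) 2).indicator (fun y => (‖y‖ ^ 2)⁻¹) y + 8 * ((1 + ‖y‖) ^ 5)⁻¹)
    with hg
  have hgi : Integrable g := by
    refine Integrable.const_mul (Integrable.add ?_ ?_) _
    · exact (integrableOn_inv_norm_sq_ball 2).integrable_indicator measurableSet_ball
    · exact (integrable_inv_one_add_norm_pow (by norm_num : 4 ≤ 5)).const_mul 8
  have hgint : ∫ y, g y = M * C₀ ^ 2 * (I₂ + 8 * K₅) := by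
    simp only [hg]
    rw [integral_const_mul, integral_add
      ((integrableOn_inv_norm_sq_ball 2).integrable_indicator measurableSet_ball)
      ((integrable_inv_one_add_norm_pow (by norm_num : 4 ≤ 5)).const_mul 8),
      integral_indicator measurableSet_ball, integral_const_mul]
  -- the pointwise bound, off the origin
  have hpt : ∀ᵐ y : (EuclideanSpace ℝ (Fin 3)) ∂volume,
      ‖fderiv ℝ (fderiv ℝ (newtonFar (4⁻¹ * 1) (4⁻¹ * 2))) (e - y) (w y) (w y)‖ ≤ g y := by
    filter_upwards [Measure.ae_ne volume (0 : (EuclideanSpace ℝ (Fin 3)))] with y hy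
    have hy0 : 0 < ‖y‖ := norm_pos_iff.2 hy
    have hwy : ‖w y‖ ≤ C₀ / ‖y‖ := by rw [le_div_iff₀ hy0]; exact hw y
    have hwy2 : ‖w y‖ ^ 2 ≤ C₀ ^ 2 * (‖y‖ ^ 2)⁻¹ := by
      rw [← div_eq_mul_inv, ← div_pow]
      exact pow_le_pow_left₀ (norm_nonneg _) hwy 2
    have hker := hM (e - y)
    have hbase : ‖fderiv ℝ (fderiv ℝ (newtonFar (4⁻¹ * 1) (4⁻¹ * 2))) (e - y) (w y) (w y)‖ ≤
        ‖fderiv ℝ (fderiv ℝ (newtonFar (4⁻¹ * 1) (4⁻¹ * 2))) (e - y)‖ * ‖w y‖ ^ 2 := by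
      rw [sq, ← mul_assoc]
      exact ContinuousLinearMap.le_opNorm₂ _ _ _
    by_cases hy2 : ‖y‖ < 2
    · -- near the origin: kernel `≤ M`, weight `≤ C₀² |y|⁻²`
      have hind : (ball (0 : (EuclideanSpace ℝ (Fin 3))) 2).indicator (fun y : (EuclideanSpace ℝ (Fin 3)) => (‖y‖ ^ 2)⁻¹) y = (‖y‖ ^ 2)⁻¹ :=
        indicator_of_mem (mem_ball_zero_iff.2 hy2) _
      have hk1 : ‖fderiv ℝ (fderiv ℝ (newtonFar (4⁻¹ * 1) (4⁻¹ * 2))) (e - y)‖ ≤ M := by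
        refine hker.trans (div_le_self hM0 ?_)
        exact one_le_pow₀ (by linarith [norm_nonneg (e - y)])
      calc ‖fderiv ℝ (fderiv ℝ (newtonFar (4⁻¹ * 1) (4⁻¹ * 2))) (e - y) (w y) (w y)‖
          ≤ M * (C₀ ^ 2 * (‖y‖ ^ 2)⁻¹) :=
            hbase.trans (mul_le_mul hk1 hwy2 (sq_nonneg _) hM0)
        _ ≤ g y := by
            simp only [hg, hind]
            have : 0 ≤ M * C₀ ^ 2 * (8 * ((1 + ‖y‖) ^ 5)⁻¹) := by positivity
            nlinarith [this]
    · -- far from the origin: `1 + |e - y| ≥ |y| ≥ (2/3)(1 + |y|)`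
      rw [not_lt] at hy2
      have hind : (ball (0 : (EuclideanSpace ℝ (Fin 3))) 2).indicator (fun y : (EuclideanSpace ℝ (Fin 3)) => (‖y‖ ^ 2)⁻¹) y = 0 :=
        indicator_of_notMem (by rw [mem_ball_zero_iff, not_lt]; exact hy2) _
      have hey : ‖y‖ ≤ 1 + ‖e - y‖ := by
        have := norm_sub_norm_le y e
        rw [norm_sub_rev] at this
        linarith
      have hk1 : ‖fderiv ℝ (fderiv ℝ (newtonFar (4⁻¹ * 1) (4⁻¹ * 2))) (e - y)‖ ≤ M / ‖y‖ ^ 3 := by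
        refine hker.trans (div_le_div_of_nonneg_left hM0 (by positivity) ?_)
        exact pow_le_pow_left₀ (norm_nonneg _) hey 3
      have h5 : M / ‖y‖ ^ 3 * (C₀ ^ 2 * (‖y‖ ^ 2)⁻¹) = M * C₀ ^ 2 / ‖y‖ ^ 5 := by
        field_simp
      -- `|y|⁻⁵ ≤ 8 (1+|y|)⁻⁵` for `|y| ≥ 2`
      have h23 : (1 + ‖y‖) ^ 5 ≤ 8 * ‖y‖ ^ 5 := by
        have h1 : 1 + ‖y‖ ≤ (3 / 2) * ‖y‖ := by linarith
        have h2 : (1 + ‖y‖) ^ 5 ≤ ((3 / 2) * ‖y‖) ^ 5 :=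
          pow_le_pow_left₀ (by positivity) h1 5
        nlinarith [h2, pow_nonneg hy0.le 5]
      have h6 : M * C₀ ^ 2 / ‖y‖ ^ 5 ≤ M * C₀ ^ 2 * (8 * ((1 + ‖y‖) ^ 5)⁻¹) := by
        rw [div_le_iff₀ (by positivity)]
        have hp : 0 < (1 + ‖y‖) ^ 5 := by positivity
        have : M * C₀ ^ 2 * (8 * ((1 + ‖y‖) ^ 5)⁻¹) * ‖y‖ ^ 5 =
            M * C₀ ^ 2 * ((8 * ‖y‖ ^ 5) / (1 + ‖y‖) ^ 5) := by
          field_simp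
        rw [this]
        have h7 : 1 ≤ (8 * ‖y‖ ^ 5) / (1 + ‖y‖) ^ 5 := by rw [le_div_iff₀ hp]; linarith
        have hMC : 0 ≤ M * C₀ ^ 2 := by positivity
        nlinarith [mul_le_mul_of_nonneg_left h7 hMC]
      calc ‖fderiv ℝ (fderiv ℝ (newtonFar (4⁻¹ * 1) (4⁻¹ * 2))) (e - y) (w y) (w y)‖
          ≤ M / ‖y‖ ^ 3 * (C₀ ^ 2 * (‖y‖ ^ 2)⁻¹) :=
            hbase.trans (mul_le_mul hk1 hwy2 (sq_nonneg _) (by positivity))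
        _ = M * C₀ ^ 2 / ‖y‖ ^ 5 := h5
        _ ≤ M * C₀ ^ 2 * (8 * ((1 + ‖y‖) ^ 5)⁻¹) := h6
        _ = g y := by simp only [hg, hind, zero_add]
  calc |farPotential (4⁻¹ * 1) (4⁻¹ * 2) w e|
      = ‖∫ y, fderiv ℝ (fderiv ℝ (newtonFar (4⁻¹ * 1) (4⁻¹ * 2))) (e - y) (w y) (w y)‖ := by
        rw [farPotential, Real.norm_eq_abs]
    _ ≤ ∫ y, g y := norm_integral_le_of_norm_le hgi hpt
    _ = M * C₀ ^ 2 * (I₂ + 8 * K₅) := hgint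
    _ = M * (I₂ + 8 * K₅) * C₀ ^ 2 := by ring

/-! ### The near potential at unit scale -/

/-- **Near part, unit scale.** There is an absolute `K` such that for every `C²` field `w` with
`|y| |w(y)| ≤ C₀`, `|y|² ‖Dw(y)‖ ≤ C₁`, `|y|³ ‖D²w(y)‖ ≤ C₂` and every unit vector `e`,
`|Q₁^{1/4,1/2}[w](e)| = |∫ Γ₀^{1/4,1/2}(z) ∂ᵢ∂ⱼ(wᵢwⱼ)(e − z) dz| ≤ K (C₂ C₀ + C₁²)`: on the support
`|z| ≤ 1/2` of `Γ₀^{1/4,1/2}` one has `|e − z| ≥ 1/2`, where the source obeys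
`|∂ᵢ∂ⱼ(wᵢwⱼ)| ≤ 2T ‖D²w‖ |w| + (T + T²) ‖Dw‖² ≤ 32 T C₂ C₀ + 16 (T + T²) C₁²`
(`abs_pressureSource_le`, `T = ‖tr‖`), against `Γ₀ ∈ L¹` (the near half of the
kernel-representation estimate behind (2.2)). [cite: PineauVicol2026, Lemma 2.1, proof of (2.2) (p. 10)] -/
theorem exists_bound_nearPotential_unitScale :
    ∃ K : ℝ, 0 ≤ K ∧ ∀ (w : (EuclideanSpace ℝ (Fin 3)) → (EuclideanSpace ℝ (Fin 3))) (C₀ C₁ C₂ : ℝ), ContDiff ℝ 2 w →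
      (∀ y, ‖w y‖ * ‖y‖ ≤ C₀) → (∀ y, ‖fderiv ℝ w y‖ * ‖y‖ ^ 2 ≤ C₁) →
      (∀ y, ‖fderiv ℝ (fderiv ℝ w) y‖ * ‖y‖ ^ 3 ≤ C₂) →
      ∀ e : (EuclideanSpace ℝ (Fin 3)), ‖e‖ = 1 → |nearPotential (4⁻¹ * 1) (4⁻¹ * 2) w e| ≤ K * (C₂ * C₀ + C₁ ^ 2) := by
  have h₀ : (0 : ℝ) ≤ 4⁻¹ * 1 := by norm_num
  have h₁ : (4⁻¹ * 1 : ℝ) < 4⁻¹ * 2 := by norm_num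
  set N : ℝ := ∫ z, |newtonNear (4⁻¹ * 1) (4⁻¹ * 2) (z : (EuclideanSpace ℝ (Fin 3)))| with hN
  have hN0 : 0 ≤ N := integral_nonneg fun _ => abs_nonneg _
  set T : ℝ := ‖(traceCLM : ((EuclideanSpace ℝ (Fin 3)) →L[ℝ] (EuclideanSpace ℝ (Fin 3))) →L[ℝ] ℝ)‖ with hT
  have hT0 : 0 ≤ T := norm_nonneg _
  refine ⟨N * (32 * T + 16 * (T + T ^ 2)), by positivity, ?_⟩
  intro w C₀ C₁ C₂ hw h0 h1 h2 e he
  have hC0 : 0 ≤ C₀ := by simpa using h0 0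
  have hC2 : 0 ≤ C₂ := by simpa using h2 0
  -- the source bound on `|y| ≥ 1/2`
  set B : ℝ := 32 * T * (C₂ * C₀) + 16 * (T + T ^ 2) * C₁ ^ 2 with hB
  have hG : ∀ y : (EuclideanSpace ℝ (Fin 3)), 2⁻¹ ≤ ‖y‖ → |pressureSource w y| ≤ B := by
    intro y hy
    have hwy : ‖w y‖ ≤ 2 * C₀ := by
      have h' : ‖w y‖ * 2⁻¹ ≤ ‖w y‖ * ‖y‖ := mul_le_mul_of_nonneg_left hy (norm_nonneg _)
      linarith [h0 y]
    have hDy : ‖fderiv ℝ w y‖ ≤ 4 * C₁ := by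
      have hy2 : (4 : ℝ)⁻¹ ≤ ‖y‖ ^ 2 := by nlinarith
      have h' : ‖fderiv ℝ w y‖ * 4⁻¹ ≤ ‖fderiv ℝ w y‖ * ‖y‖ ^ 2 :=
        mul_le_mul_of_nonneg_left hy2 (norm_nonneg _)
      linarith [h1 y]
    have hD2y : ‖fderiv ℝ (fderiv ℝ w) y‖ ≤ 8 * C₂ := by
      have hy3 : (8 : ℝ)⁻¹ ≤ ‖y‖ ^ 3 := by
        have := pow_le_pow_left₀ (by norm_num : (0 : ℝ) ≤ 2⁻¹) hy 3
        norm_num at this ⊢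
        exact this
      have h' : ‖fderiv ℝ (fderiv ℝ w) y‖ * 8⁻¹ ≤ ‖fderiv ℝ (fderiv ℝ w) y‖ * ‖y‖ ^ 3 :=
        mul_le_mul_of_nonneg_left hy3 (norm_nonneg _)
      linarith [h2 y]
    have hsrc := abs_pressureSource_le hw y
    rw [← hT] at hsrc
    have e1 : ‖fderiv ℝ (fderiv ℝ w) y‖ * ‖w y‖ ≤ 8 * C₂ * (2 * C₀) :=
      mul_le_mul hD2y hwy (norm_nonneg _) (by positivity)
    have e2 : ‖fderiv ℝ w y‖ ^ 2 ≤ (4 * C₁) ^ 2 := pow_le_pow_left₀ (norm_nonneg _) hDy 2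
    calc |pressureSource w y|
        ≤ 2 * T * ‖fderiv ℝ (fderiv ℝ w) y‖ * ‖w y‖ + (T + T ^ 2) * ‖fderiv ℝ w y‖ ^ 2 := hsrc
      _ = 2 * T * (‖fderiv ℝ (fderiv ℝ w) y‖ * ‖w y‖) + (T + T ^ 2) * ‖fderiv ℝ w y‖ ^ 2 := by
          ring
      _ ≤ 2 * T * (8 * C₂ * (2 * C₀)) + (T + T ^ 2) * (4 * C₁) ^ 2 :=
          add_le_add (mul_le_mul_of_nonneg_left e1 (by positivity))
            (mul_le_mul_of_nonneg_left e2 (by positivity))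
      _ = B := by simp only [hB]; ring
  -- the integrand bound: `Γ₀^{1/4,1/2}(z) = 0` unless `|z| < 1/2`, where `|e - z| ≥ 1/2`
  have hGb : ∀ z : (EuclideanSpace ℝ (Fin 3)), ‖newtonNear (4⁻¹ * 1) (4⁻¹ * 2) z * pressureSource w (e - z)‖ ≤
      B * |newtonNear (4⁻¹ * 1) (4⁻¹ * 2) z| := by
    intro z
    rw [norm_mul, Real.norm_eq_abs, Real.norm_eq_abs, mul_comm]
    by_cases hz : 4⁻¹ * 2 ≤ ‖z‖
    · rw [newtonNear_eq_zero h₀ h₁ hz, abs_zero, mul_zero, mul_zero]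
    · rw [not_le] at hz
      refine mul_le_mul_of_nonneg_right (hG (e - z) ?_) (abs_nonneg _)
      have := norm_sub_norm_le e z
      rw [he] at this
      linarith
  calc |nearPotential (4⁻¹ * 1) (4⁻¹ * 2) w e|
      = ‖∫ z, newtonNear (4⁻¹ * 1) (4⁻¹ * 2) z * pressureSource w (e - z)‖ := by
        rw [nearPotential, Real.norm_eq_abs]
    _ ≤ ∫ z, B * |newtonNear (4⁻¹ * 1) (4⁻¹ * 2) z| :=
        norm_integral_le_of_norm_le (((integrable_newtonNear h₀ h₁).abs).const_mul B)
          (Eventually.of_forall hGb)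
    _ = B * N := by rw [integral_const_mul]
    _ ≤ N * (32 * T + 16 * (T + T ^ 2)) * (C₂ * C₀ + C₁ ^ 2) := by
        have e : N * (32 * T + 16 * (T + T ^ 2)) * (C₂ * C₀ + C₁ ^ 2) - B * N =
            N * (32 * T) * C₁ ^ 2 + N * (16 * (T + T ^ 2)) * (C₂ * C₀) := by
          simp only [hB]; ring
        nlinarith [mul_nonneg (mul_nonneg hN0 (by positivity : (0 : ℝ) ≤ 32 * T)) (sq_nonneg C₁),
          mul_nonneg (mul_nonneg hN0 (by positivity : (0 : ℝ) ≤ 16 * (T + T ^ 2)))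
            (mul_nonneg hC2 hC0)]

/-! ### The Navier–Stokes dilation `w = λ v(λ ·)` of a field in the decay class -/

/-- `aᵏ · C/(1+a)ᵏ ≤ C` for `a, C ≥ 0`. [folklore] -/
private theorem pow_mul_div_one_add_pow_le {a C : ℝ} (ha : 0 ≤ a) (hC : 0 ≤ C) (k : ℕ) :
    a ^ k * (C / (1 + a) ^ k) ≤ C := by
  have h1 : a ^ k ≤ (1 + a) ^ k := pow_le_pow_left₀ ha (by linarith) k
  have hp : 0 < (1 + a) ^ k := by positivity
  rw [mul_div_assoc', div_le_iff₀ hp]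
  nlinarith [mul_le_mul_of_nonneg_left h1 hC]

/-- The dilation `w(z) = λ v(λ z)`, `λ > 0`, of a field with `(1+|y|)|v(y)| ≤ C₀` stays in the decay
class, with constant `max(λ,1) C₀` (the rescaling `ũ = r u(y + r x̃)` of the source's proof).
[cite: PineauVicol2026, Lemma 2.1, proof of (2.1) (p. 9–10)] -/
theorem norm_smul_comp_smul_le_decay {v : (EuclideanSpace ℝ (Fin 3)) → (EuclideanSpace ℝ (Fin 3))} {C₀ : ℝ} (hv : ∀ y, ‖v y‖ ≤ C₀ / (1 + ‖y‖))
    {lam : ℝ} (hlam : 0 < lam) (y : (EuclideanSpace ℝ (Fin 3))) :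
    ‖lam • v (lam • y)‖ ≤ max lam 1 * C₀ / (1 + ‖y‖) := by
  have hC0 : 0 ≤ C₀ := by
    have h := (norm_nonneg _).trans (hv 0); rw [norm_zero, add_zero, div_one] at h; exact h
  have h := hv (lam • y)
  rw [norm_smul, Real.norm_eq_abs, abs_of_pos hlam] at h ⊢
  have hden : 0 < 1 + lam * ‖y‖ := by positivity
  have hden' : 0 < 1 + ‖y‖ := by positivity
  have hmax1 : 1 ≤ max lam 1 := le_max_right _ _
  have hmaxl : lam ≤ max lam 1 := le_max_left _ _
  rw [le_div_iff₀ hden']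
  calc lam * ‖v (lam • y)‖ * (1 + ‖y‖) ≤ lam * (C₀ / (1 + lam * ‖y‖)) * (1 + ‖y‖) :=
        mul_le_mul_of_nonneg_right (mul_le_mul_of_nonneg_left h hlam.le) hden'.le
    _ = (lam * (1 + ‖y‖)) * C₀ / (1 + lam * ‖y‖) := by ring
    _ ≤ (max lam 1 * (1 + lam * ‖y‖)) * C₀ / (1 + lam * ‖y‖) := by
        refine div_le_div_of_nonneg_right (mul_le_mul_of_nonneg_right ?_ hC0) hden.le
        nlinarith [mul_le_mul_of_nonneg_right hmaxl (norm_nonneg y),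
          mul_le_mul_of_nonneg_right hmax1 (mul_nonneg hlam.le (norm_nonneg y))]
    _ = max lam 1 * C₀ := by field_simp

/-- For the dilation `w(z) = λ v(λ z)`: `|y| |w(y)| ≤ C₀` from `(1+|y|)|v(y)| ≤ C₀` — the constant
does not see `λ` (the rescaling `ũ = r u(y + r x̃)`, "a bound which is independent of `y`").
[cite: PineauVicol2026, Lemma 2.1, proof of (2.1) (p. 9–10)] -/
theorem norm_smul_comp_smul_mul_norm_le {v : (EuclideanSpace ℝ (Fin 3)) → (EuclideanSpace ℝ (Fin 3))} {C₀ : ℝ} (hv : ∀ y, ‖v y‖ ≤ C₀ / (1 + ‖y‖))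
    {lam : ℝ} (hlam : 0 < lam) (y : (EuclideanSpace ℝ (Fin 3))) : ‖lam • v (lam • y)‖ * ‖y‖ ≤ C₀ := by
  have hC0 : 0 ≤ C₀ := by
    have h := (norm_nonneg _).trans (hv 0); rw [norm_zero, add_zero, div_one] at h; exact h
  have h := hv (lam • y)
  rw [norm_smul, Real.norm_eq_abs, abs_of_pos hlam] at h ⊢
  calc lam * ‖v (lam • y)‖ * ‖y‖ = (lam * ‖y‖) ^ 1 * ‖v (lam • y)‖ := by ring
    _ ≤ (lam * ‖y‖) ^ 1 * (C₀ / (1 + lam * ‖y‖) ^ 1) := by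
        rw [pow_one (1 + lam * ‖y‖)]
        exact mul_le_mul_of_nonneg_left h (by positivity)
    _ ≤ C₀ := pow_mul_div_one_add_pow_le (by positivity) hC0 1

/-- For the dilation `w(z) = λ v(λ z)`: `|y|² ‖Dw(y)‖ ≤ C₁` from `(1+|y|)² ‖Dv(y)‖ ≤ C₁`
(`Dw(y) = λ² Dv(λy)`; the rescaling of the source's proof).
[cite: PineauVicol2026, Lemma 2.1, proof of (2.1) (p. 9–10)] -/
theorem norm_fderiv_smul_comp_smul_mul_norm_sq_le {v : (EuclideanSpace ℝ (Fin 3)) → (EuclideanSpace ℝ (Fin 3))} {C₁ : ℝ}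
    (hv : ∀ y, ‖fderiv ℝ v y‖ ≤ C₁ / (1 + ‖y‖) ^ 2) {lam : ℝ} (hlam : 0 < lam) (y : (EuclideanSpace ℝ (Fin 3))) :
    ‖fderiv ℝ (fun z => lam • v (lam • z)) y‖ * ‖y‖ ^ 2 ≤ C₁ := by
  have hC1 : 0 ≤ C₁ := by
    have h := (norm_nonneg _).trans (hv 0); rw [norm_zero, add_zero, one_pow, div_one] at h; exact h
  have h := hv (lam • y)
  rw [norm_smul, Real.norm_eq_abs, abs_of_pos hlam] at h
  rw [fderiv_const_smul_comp_smul v lam hlam.ne', norm_smul, Real.norm_eq_abs,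
    abs_of_pos (mul_pos hlam hlam)]
  calc lam * lam * ‖fderiv ℝ v (lam • y)‖ * ‖y‖ ^ 2
      = (lam * ‖y‖) ^ 2 * ‖fderiv ℝ v (lam • y)‖ := by ring
    _ ≤ (lam * ‖y‖) ^ 2 * (C₁ / (1 + lam * ‖y‖) ^ 2) := mul_le_mul_of_nonneg_left h (by positivity)
    _ ≤ C₁ := pow_mul_div_one_add_pow_le (by positivity) hC1 2

/-- For the dilation `w(z) = λ v(λ z)`: `|y|³ ‖D²w(y)‖ ≤ C₂` from `(1+|y|)³ ‖D²v(y)‖ ≤ C₂`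
(`D²w(y) = λ³ D²v(λy)`; the rescaling of the source's proof).
[cite: PineauVicol2026, Lemma 2.1, proof of (2.1) (p. 9–10)] -/
theorem norm_fderiv2_smul_comp_smul_mul_norm_cube_le {v : (EuclideanSpace ℝ (Fin 3)) → (EuclideanSpace ℝ (Fin 3))} {C₂ : ℝ}
    (hv : ∀ y, ‖fderiv ℝ (fderiv ℝ v) y‖ ≤ C₂ / (1 + ‖y‖) ^ 3) {lam : ℝ} (hlam : 0 < lam) (y : (EuclideanSpace ℝ (Fin 3))) :
    ‖fderiv ℝ (fderiv ℝ (fun z => lam • v (lam • z))) y‖ * ‖y‖ ^ 3 ≤ C₂ := by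
  have hC2 : 0 ≤ C₂ := by
    have h := (norm_nonneg _).trans (hv 0); rw [norm_zero, add_zero, one_pow, div_one] at h; exact h
  have h := hv (lam • y)
  rw [norm_smul, Real.norm_eq_abs, abs_of_pos hlam] at h
  rw [fderiv2_const_smul_comp_smul v lam hlam.ne', norm_smul, Real.norm_eq_abs,
    abs_of_pos (mul_pos hlam (pow_pos hlam 2))]
  calc lam * lam ^ 2 * ‖fderiv ℝ (fderiv ℝ v) (lam • y)‖ * ‖y‖ ^ 3
      = (lam * ‖y‖) ^ 3 * ‖fderiv ℝ (fderiv ℝ v) (lam • y)‖ := by ring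
    _ ≤ (lam * ‖y‖) ^ 3 * (C₂ / (1 + lam * ‖y‖) ^ 3) := mul_le_mul_of_nonneg_left h (by positivity)
    _ ≤ C₂ := pow_mul_div_one_add_pow_le (by positivity) hC2 3

/-! ### A uniform bound for the pressure potential on the decay class -/

/-- **`|Q[v](x)| ≤ K (C₂C₀ + C₁² + C₀²)` for all `x`** for `v ∈ C²` with `(1+|y|)|v| ≤ C₀`,
`(1+|y|)² ‖Dv‖ ≤ C₁`, `(1+|y|)³ ‖D²v‖ ≤ C₂` (cutoff radii `(1,2)`: near part `Γ₀ ∈ L¹` against the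
source bound `abs_pressureSource_le`, far part `exists_bound_farPotential_scale_decay`) — the
kernel-representation estimate behind (2.2) without decay. [cite: PineauVicol2026, Lemma 2.1, proof of (2.2) (p. 10)] -/
theorem exists_bound_abs_pressurePotential_of_decay :
    ∃ K : ℝ, 0 ≤ K ∧ ∀ (v : (EuclideanSpace ℝ (Fin 3)) → (EuclideanSpace ℝ (Fin 3))) (C₀ C₁ C₂ : ℝ), ContDiff ℝ 2 v →
      (∀ y, ‖v y‖ ≤ C₀ / (1 + ‖y‖)) → (∀ y, ‖fderiv ℝ v y‖ ≤ C₁ / (1 + ‖y‖) ^ 2) →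
      (∀ y, ‖fderiv ℝ (fderiv ℝ v) y‖ ≤ C₂ / (1 + ‖y‖) ^ 3) →
      ∀ x, |pressurePotential v x| ≤ K * (C₂ * C₀ + C₁ ^ 2 + C₀ ^ 2) := by
  obtain ⟨Kf, hKf0, hKf⟩ := exists_bound_farPotential_scale_decay
  set N₁ : ℝ := ∫ z, |newtonNear (1 : ℝ) 2 (z : (EuclideanSpace ℝ (Fin 3)))| with hN₁
  have hN₁0 : 0 ≤ N₁ := integral_nonneg fun _ => abs_nonneg _
  set T : ℝ := ‖(traceCLM : ((EuclideanSpace ℝ (Fin 3)) →L[ℝ] (EuclideanSpace ℝ (Fin 3))) →L[ℝ] ℝ)‖ with hT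
  have hT0 : 0 ≤ T := norm_nonneg _
  refine ⟨N₁ * (2 * T + (T + T ^ 2)) + Kf, by positivity, ?_⟩
  intro v C₀ C₁ C₂ hv2 h0 h1 h2 x
  have hC0 : 0 ≤ C₀ := by
    have h := (norm_nonneg _).trans (h0 0); rw [norm_zero, add_zero, div_one] at h; exact h
  have hC2 : 0 ≤ C₂ := by
    have h := (norm_nonneg _).trans (h2 0); rw [norm_zero, add_zero, one_pow, div_one] at h; exact h
  -- uniform bounds
  have hvb : ∀ y, ‖v y‖ ≤ C₀ := fun y =>
    (h0 y).trans (div_le_self hC0 (by linarith [norm_nonneg y]))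
  have hK₁ : ∀ y, ‖fderiv ℝ v y‖ ≤ C₁ := by
    intro y
    have hC1 : 0 ≤ C₁ := by
      have h := (norm_nonneg _).trans (h1 0); rw [norm_zero, add_zero, one_pow, div_one] at h; exact h
    exact (h1 y).trans (div_le_self hC1 (one_le_pow₀ (by linarith [norm_nonneg y])))
  have hK₂ : ∀ y, ‖fderiv ℝ (fderiv ℝ v) y‖ ≤ C₂ := fun y =>
    (h2 y).trans (div_le_self hC2 (one_le_pow₀ (by linarith [norm_nonneg y])))
  -- pointwise source bound
  have hG : ∀ y, |pressureSource v y| ≤ 2 * T * (C₂ * C₀) + (T + T ^ 2) * C₁ ^ 2 := by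
    intro y
    have e1 : ‖fderiv ℝ (fderiv ℝ v) y‖ * ‖v y‖ ≤ C₂ * C₀ :=
      mul_le_mul (hK₂ y) (hvb y) (norm_nonneg _) hC2
    have e2 : ‖fderiv ℝ v y‖ ^ 2 ≤ C₁ ^ 2 := pow_le_pow_left₀ (norm_nonneg _) (hK₁ y) 2
    have hsrc := abs_pressureSource_le hv2 y
    rw [← hT] at hsrc
    calc |pressureSource v y|
        ≤ 2 * T * ‖fderiv ℝ (fderiv ℝ v) y‖ * ‖v y‖ + (T + T ^ 2) * ‖fderiv ℝ v y‖ ^ 2 := hsrc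
      _ = 2 * T * (‖fderiv ℝ (fderiv ℝ v) y‖ * ‖v y‖) + (T + T ^ 2) * ‖fderiv ℝ v y‖ ^ 2 := by ring
      _ ≤ 2 * T * (C₂ * C₀) + (T + T ^ 2) * C₁ ^ 2 :=
          add_le_add (mul_le_mul_of_nonneg_left e1 (by positivity))
            (mul_le_mul_of_nonneg_left e2 (by positivity))
  -- near part
  have hnear : |nearPotential 1 2 v x| ≤ N₁ * (2 * T * (C₂ * C₀) + (T + T ^ 2) * C₁ ^ 2) := by
    rw [nearPotential, ← Real.norm_eq_abs]
    have hGb : ∀ z : (EuclideanSpace ℝ (Fin 3)), ‖newtonNear 1 2 z * pressureSource v (x - z)‖ ≤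
        (2 * T * (C₂ * C₀) + (T + T ^ 2) * C₁ ^ 2) * |newtonNear 1 2 z| := by
      intro z
      rw [norm_mul, Real.norm_eq_abs, Real.norm_eq_abs, mul_comm]
      exact mul_le_mul_of_nonneg_right (hG (x - z)) (abs_nonneg _)
    refine (norm_integral_le_of_norm_le
      (((integrable_newtonNear zero_le_one one_lt_two).abs).const_mul _)
      (Eventually.of_forall hGb)).trans ?_
    rw [integral_const_mul, mul_comm]
  -- far part
  have hfar : |farPotential 1 2 v x| ≤ Kf * C₀ ^ 2 := by
    have := hKf v C₀ hv2.continuous h0 1 le_rfl x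
    simpa using this
  rw [pressurePotential]
  have hA1 : 0 ≤ N₁ * (2 * T) := by positivity
  have hA2 : 0 ≤ N₁ * (T + T ^ 2) := by positivity
  have ha : 0 ≤ C₂ * C₀ := mul_nonneg hC2 hC0
  have hb : 0 ≤ C₁ ^ 2 := sq_nonneg _
  have hd : 0 ≤ C₀ ^ 2 := sq_nonneg _
  calc |-nearPotential 1 2 v x - farPotential 1 2 v x|
      ≤ |nearPotential 1 2 v x| + |farPotential 1 2 v x| := by
        rw [show -nearPotential 1 2 v x - farPotential 1 2 v x =
          -(nearPotential 1 2 v x + farPotential 1 2 v x) by ring, abs_neg]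
        exact abs_add_le _ _
    _ ≤ N₁ * (2 * T * (C₂ * C₀) + (T + T ^ 2) * C₁ ^ 2) + Kf * C₀ ^ 2 := add_le_add hnear hfar
    _ ≤ (N₁ * (2 * T + (T + T ^ 2)) + Kf) * (C₂ * C₀ + C₁ ^ 2 + C₀ ^ 2) := by
        have e : (N₁ * (2 * T + (T + T ^ 2)) + Kf) * (C₂ * C₀ + C₁ ^ 2 + C₀ ^ 2) -
            (N₁ * (2 * T * (C₂ * C₀) + (T + T ^ 2) * C₁ ^ 2) + Kf * C₀ ^ 2) =
            N₁ * (2 * T) * (C₁ ^ 2 + C₀ ^ 2) + N₁ * (T + T ^ 2) * (C₂ * C₀ + C₀ ^ 2) +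
              Kf * (C₂ * C₀ + C₁ ^ 2) := by ring
        nlinarith [mul_nonneg hA1 (add_nonneg hb hd), mul_nonneg hA2 (add_nonneg ha hd),
          mul_nonneg hKf0 (add_nonneg ha hb)]

/-! ### Pointwise decay of the pressure potential -/

/-- **Pineau–Vicol 2026, Lemma 2.1, (2.2) — pointwise decay of the pressure, on the decay class,
with `σ = 0`.** There is an absolute `A` such that for every `v ∈ C²(ℝ³)` with
`(1+|y|)|v(y)| ≤ C₀`, `(1+|y|)² ‖Dv(y)‖ ≤ C₁`, `(1+|y|)³ ‖D²v(y)‖ ≤ C₂` (the Type I decay (1.9),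
(2.1)), the Calderón–Zygmund pressure `P = Q[v] = RᵢRⱼ(vᵢvⱼ)` (`pressurePotential`) satisfies
`|P(x)| ≤ A (C₂C₀ + C₁² + C₀²) (1+|x|)⁻²` for all `x`.

The source states `|P(y)| ≤ C_{P,0}(C_{U,0}, σ)/(1+|y|^{2−σ})` for any `σ ∈ (0,1)` and proves it
"from the singular integral kernel representation of `P = RᵢRⱼ(UⁱUʲ)`, and the previously
established bounds for `U` and `∇U`" (proof, p. 10). Here, Calderón–Zygmund-free: by the
Navier–Stokes dilation covariance `Q[λv(λ·)](e) = λ² Q[v](λe)` (`pressurePotential_smul_comp_smul`)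
with `λ = |x|`, `e = x/|x|`, the bound at `x` is `|x|⁻²` times a bound at the unit vector `e` for the
dilated field `w = λv(λ·)`, whose weighted constants `|y| |w| ≤ C₀`, `|y|² ‖Dw‖ ≤ C₁`,
`|y|³ ‖D²w‖ ≤ C₂` do not see `λ`; at `e` the cutoff scale `(1/4, 1/2)`
(`pressurePotential_eq_scale_decay`) separates the near part (`exists_bound_nearPotential_unitScale`,
this is where `D²v` enters) from the far part against the locally integrable weight `|y|⁻²`
(`exists_bound_farPotential_unitScale`); `|x| ≤ 1` is covered by the uniform bound
`exists_bound_abs_pressurePotential_of_decay`. The exponent is the sharp `2` (no `σ`-loss), at the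
price of the second-derivative constant `C_{U,2}` of (2.1), which the source's statement does not
use. [cite: PineauVicol2026, Lemma 2.1 (2.2) (p. 9), proof p. 10] -/
theorem exists_bound_abs_pressurePotential_decay :
    ∃ A : ℝ, 0 ≤ A ∧ ∀ (v : (EuclideanSpace ℝ (Fin 3)) → (EuclideanSpace ℝ (Fin 3))) (C₀ C₁ C₂ : ℝ), ContDiff ℝ 2 v →
      (∀ y, ‖v y‖ ≤ C₀ / (1 + ‖y‖)) → (∀ y, ‖fderiv ℝ v y‖ ≤ C₁ / (1 + ‖y‖) ^ 2) →
      (∀ y, ‖fderiv ℝ (fderiv ℝ v) y‖ ≤ C₂ / (1 + ‖y‖) ^ 3) →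
      ∀ x, |pressurePotential v x| ≤ A * (C₂ * C₀ + C₁ ^ 2 + C₀ ^ 2) / (1 + ‖x‖) ^ 2 := by
  obtain ⟨Kn, hKn0, hKn⟩ := exists_bound_nearPotential_unitScale
  obtain ⟨Kf, hKf0, hKf⟩ := exists_bound_farPotential_unitScale
  obtain ⟨Kg, hKg0, hKg⟩ := exists_bound_abs_pressurePotential_of_decay
  refine ⟨4 * (Kn + Kf + Kg), by positivity, ?_⟩
  intro v C₀ C₁ C₂ hv2 h0 h1 h2 x
  have hC0 : 0 ≤ C₀ := by
    have h := (norm_nonneg _).trans (h0 0); rw [norm_zero, add_zero, div_one] at h; exact h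
  have hC2 : 0 ≤ C₂ := by
    have h := (norm_nonneg _).trans (h2 0); rw [norm_zero, add_zero, one_pow, div_one] at h; exact h
  have hS0 : 0 ≤ C₂ * C₀ + C₁ ^ 2 + C₀ ^ 2 := by positivity
  have hpos : 0 < (1 + ‖x‖) ^ 2 := by positivity
  rw [le_div_iff₀ hpos]
  by_cases hx : ‖x‖ ≤ 1
  · -- `|x| ≤ 1`: the uniform bound, `(1+|x|)² ≤ 4`
    have h := hKg v C₀ C₁ C₂ hv2 h0 h1 h2 x
    have h4 : (1 + ‖x‖) ^ 2 ≤ 4 := by nlinarith [norm_nonneg x]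
    calc |pressurePotential v x| * (1 + ‖x‖) ^ 2
        ≤ Kg * (C₂ * C₀ + C₁ ^ 2 + C₀ ^ 2) * 4 := mul_le_mul h h4 hpos.le (by positivity)
      _ ≤ 4 * (Kn + Kf + Kg) * (C₂ * C₀ + C₁ ^ 2 + C₀ ^ 2) := by
          nlinarith [mul_nonneg (add_nonneg hKn0 hKf0) hS0]
  · -- `|x| > 1`: dilate by `λ = |x|` and estimate at the unit vector `e = x/|x|`
    rw [not_le] at hx
    have hlam : 0 < ‖x‖ := by linarith
    have he : ‖‖x‖⁻¹ • x‖ = 1 := by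
      rw [norm_smul, norm_inv, norm_norm, inv_mul_cancel₀ hlam.ne']
    have hxe : ‖x‖ • (‖x‖⁻¹ • x) = x := by
      rw [smul_smul, mul_inv_cancel₀ hlam.ne', one_smul]
    -- the dilated field and its scale-free weighted constants
    have hw2 : ContDiff ℝ 2 (fun z => ‖x‖ • v (‖x‖ • z)) :=
      (hv2.comp (contDiff_id.const_smul ‖x‖)).const_smul ‖x‖
    have hwdec := norm_smul_comp_smul_le_decay h0 hlam
    have hw0 := norm_smul_comp_smul_mul_norm_le h0 hlam
    have hw1 := norm_fderiv_smul_comp_smul_mul_norm_sq_le h1 hlam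
    have hw2' := norm_fderiv2_smul_comp_smul_mul_norm_cube_le h2 hlam
    -- dilation covariance and the split at scale `1/4`
    have hsc := pressurePotential_smul_comp_smul hv2 h0 hlam (‖x‖⁻¹ • x)
    rw [hxe] at hsc
    have hsplit := pressurePotential_eq_scale_decay (R := 4⁻¹) (by norm_num) hw2 hwdec (‖x‖⁻¹ • x)
    have hn := hKn _ C₀ C₁ C₂ hw2 hw0 hw1 hw2' _ he
    have hf := hKf _ C₀ hw0 _ he.le
    -- the bound at the unit vector
    have hQw : |pressurePotential (fun z => ‖x‖ • v (‖x‖ • z)) (‖x‖⁻¹ • x)| ≤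
        (Kn + Kf) * (C₂ * C₀ + C₁ ^ 2 + C₀ ^ 2) := by
      rw [hsplit]
      calc |-nearPotential (4⁻¹ * 1) (4⁻¹ * 2) (fun z => ‖x‖ • v (‖x‖ • z)) (‖x‖⁻¹ • x) -
              farPotential (4⁻¹ * 1) (4⁻¹ * 2) (fun z => ‖x‖ • v (‖x‖ • z)) (‖x‖⁻¹ • x)|
          ≤ |nearPotential (4⁻¹ * 1) (4⁻¹ * 2) (fun z => ‖x‖ • v (‖x‖ • z)) (‖x‖⁻¹ • x)| +
              |farPotential (4⁻¹ * 1) (4⁻¹ * 2) (fun z => ‖x‖ • v (‖x‖ • z)) (‖x‖⁻¹ • x)| := by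
            rw [show ∀ a b : ℝ, -a - b = -(a + b) from fun a b => by ring, abs_neg]
            exact abs_add_le _ _
        _ ≤ Kn * (C₂ * C₀ + C₁ ^ 2) + Kf * C₀ ^ 2 := add_le_add hn hf
        _ ≤ (Kn + Kf) * (C₂ * C₀ + C₁ ^ 2 + C₀ ^ 2) := by
            nlinarith [mul_nonneg hKn0 (sq_nonneg C₀), mul_nonneg hKf0 (by positivity : (0 : ℝ) ≤ C₂ * C₀ + C₁ ^ 2)]
    -- undo the dilation: `|Q[v](x)| |x|² = |Q[w](e)|`, and `(1+|x|)² ≤ 4|x|²`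
    have hQv : |pressurePotential v x| * ‖x‖ ^ 2 =
        |pressurePotential (fun z => ‖x‖ • v (‖x‖ • z)) (‖x‖⁻¹ • x)| := by
      rw [hsc, abs_mul, abs_of_pos (pow_pos hlam 2), mul_comm]
    have h4 : (1 + ‖x‖) ^ 2 ≤ 4 * ‖x‖ ^ 2 := by nlinarith
    calc |pressurePotential v x| * (1 + ‖x‖) ^ 2
        ≤ |pressurePotential v x| * (4 * ‖x‖ ^ 2) := mul_le_mul_of_nonneg_left h4 (abs_nonneg _)
      _ = 4 * (|pressurePotential v x| * ‖x‖ ^ 2) := by ring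
      _ ≤ 4 * ((Kn + Kf) * (C₂ * C₀ + C₁ ^ 2 + C₀ ^ 2)) := by
          rw [hQv]; exact mul_le_mul_of_nonneg_left hQw (by norm_num)
      _ ≤ 4 * (Kn + Kf + Kg) * (C₂ * C₀ + C₁ ^ 2 + C₀ ^ 2) := by
          nlinarith [mul_nonneg hKg0 hS0]

/-- **Pineau–Vicol 2026, Lemma 2.1 (2.2), `σ = 0`, in the printed shape of (1.9)/(2.1)**: with the
hypotheses `|v| ≤ C₀/(1+|y|)`, `‖Dv‖ ≤ C₁/(1+|y|²)`, `‖D²v‖ ≤ C₂/(1+|y|³)` and the conclusion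
`|P(y)| ≤ C_P/(1+|y|^s)` at the real exponent `s = 2` — the form consumed by `pineauVicol_8_6'` /
`pineauVicol_prop_8_3'` (any `s > 3/2`). [cite: PineauVicol2026, Lemma 2.1 (2.2) (p. 9)] -/
theorem exists_bound_abs_pressurePotential_decay' :
    ∃ A : ℝ, 0 ≤ A ∧ ∀ (v : (EuclideanSpace ℝ (Fin 3)) → (EuclideanSpace ℝ (Fin 3))) (C₀ C₁ C₂ : ℝ), ContDiff ℝ 2 v →
      (∀ y, ‖v y‖ ≤ C₀ / (1 + ‖y‖)) → (∀ y, ‖fderiv ℝ v y‖ ≤ C₁ / (1 + ‖y‖ ^ 2)) →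
      (∀ y, ‖fderiv ℝ (fderiv ℝ v) y‖ ≤ C₂ / (1 + ‖y‖ ^ 3)) →
      ∀ y, |pressurePotential v y| ≤ A * (C₂ * C₀ + C₁ ^ 2 + C₀ ^ 2) / (1 + ‖y‖ ^ (2 : ℝ)) := by
  obtain ⟨A, hA0, hA⟩ := exists_bound_abs_pressurePotential_decay
  refine ⟨4 * A, by positivity, ?_⟩
  intro v C₀ C₁ C₂ hv2 h0 h1 h2 y
  have hC0 : 0 ≤ C₀ := by
    have h := (norm_nonneg _).trans (h0 0); rw [norm_zero, add_zero, div_one] at h; exact h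
  have hC1 : 0 ≤ C₁ := by
    have h := (norm_nonneg _).trans (h1 0); rw [norm_zero] at h; norm_num at h; exact h
  have hC2 : 0 ≤ C₂ := by
    have h := (norm_nonneg _).trans (h2 0); rw [norm_zero] at h; norm_num at h; exact h
  -- `(1+a)² ≤ 2(1+a²)`, `(1+a)³ ≤ 4(1+a³)`
  have h1' : ∀ z : (EuclideanSpace ℝ (Fin 3)), ‖fderiv ℝ v z‖ ≤ 2 * C₁ / (1 + ‖z‖) ^ 2 := by
    intro z
    refine (h1 z).trans ?_
    rw [div_le_div_iff₀ (by positivity) (by positivity)]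
    nlinarith [norm_nonneg z, sq_nonneg (‖z‖ - 1), hC1]
  have h2' : ∀ z : (EuclideanSpace ℝ (Fin 3)), ‖fderiv ℝ (fderiv ℝ v) z‖ ≤ 4 * C₂ / (1 + ‖z‖) ^ 3 := by
    intro z
    refine (h2 z).trans ?_
    rw [div_le_div_iff₀ (by positivity) (by positivity)]
    have ha := norm_nonneg z
    have key : (1 + ‖z‖) ^ 3 ≤ 4 * (1 + ‖z‖ ^ 3) := by
      nlinarith [sq_nonneg (‖z‖ - 1), mul_nonneg (sq_nonneg (‖z‖ - 1)) ha]
    nlinarith [key, hC2, pow_nonneg ha 3]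
  have h := hA v C₀ (2 * C₁) (4 * C₂) hv2 h0 h1' h2' y
  have hp1 : 0 < (1 + ‖y‖) ^ 2 := by positivity
  have hp2 : 0 < 1 + ‖y‖ ^ (2 : ℝ) := by positivity
  rw [Real.rpow_two] at hp2 ⊢
  rw [le_div_iff₀ hp2]
  rw [le_div_iff₀ hp1] at h
  have hle : 1 + ‖y‖ ^ 2 ≤ (1 + ‖y‖) ^ 2 := by nlinarith [norm_nonneg y]
  have hS0 : 0 ≤ C₂ * C₀ + C₁ ^ 2 + C₀ ^ 2 := by positivity
  calc |pressurePotential v y| * (1 + ‖y‖ ^ 2)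
      ≤ |pressurePotential v y| * (1 + ‖y‖) ^ 2 := mul_le_mul_of_nonneg_left hle (abs_nonneg _)
    _ ≤ A * (4 * C₂ * C₀ + (2 * C₁) ^ 2 + C₀ ^ 2) := h
    _ ≤ 4 * A * (C₂ * C₀ + C₁ ^ 2 + C₀ ^ 2) := by
        nlinarith [mul_nonneg hA0 (sq_nonneg C₀), mul_nonneg hA0 hS0]

/-! ### Proposition 8.3 on a slice for the Calderón–Zygmund pressure, hypotheses on the profile only -/

/-- **Pineau–Vicol 2026, Proposition 8.3 (8.6) on a slice, for the Calderón–Zygmund pressure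
`P = RᵢRⱼ(UⁱUʲ)` of the slice, with hypotheses on the profile only.** As `pineauVicol_prop_8_3'`,
with `P := Q[U]` (`pressurePotential U`): the pressure decay (2.2) is now PROVED
(`exists_bound_abs_pressurePotential_decay'`, exponent `2 > 3/2`) and the Poisson equation
`ΔP = −∇·((U·∇)U)` is the tree's `laplacian_pressurePotential_decay` (Gilbarg–Trudinger Lemma 4.2
on the decay class) with `pressureSource_eq_of_isDivFree`; what remains assumed is the profile's
regularity/decay (1.9), (2.1) (`U ∈ C⁴`, divergence free) and Lemma 8.1's slice-source bound (8.2)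
on `F = ∂ₛU`. [cite: PineauVicol2026, Proposition 8.3 (8.6) (p. 28); Lemma 2.1 (2.2) (p. 9)] -/
theorem pineauVicol_prop_8_3'' (C₀ C₁ C₂ Cs : ℝ) {ε : ℝ} (hε : 0 < ε) :
    ∃ A : ℝ, 1 ≤ A ∧ ∃ δ : ℝ, 0 < δ ∧
      ∀ (U F : (EuclideanSpace ℝ (Fin 3)) → (EuclideanSpace ℝ (Fin 3))) (α Sper : ℝ), ContDiff ℝ 4 U → VectorCalculus.IsDivFree U →
        (∀ y, ‖U y‖ ≤ C₀ / (1 + ‖y‖)) → (∀ y, ‖fderiv ℝ U y‖ ≤ C₁ / (1 + ‖y‖ ^ 2)) →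
        (∀ y, ‖fderiv ℝ (fderiv ℝ U) y‖ ≤ C₂ / (1 + ‖y‖ ^ 3)) →
        Continuous F → 0 ≤ Sper → (∀ y, ‖F y‖ ≤ Cs * Sper * (1 + |α|) ^ 2 / (1 + ‖y‖)) →
        (∀ y, α • (rotGen (U y) - fderiv ℝ U y (rotGen y)) + (1 / 2 : ℝ) • U y +
          (1 / 2 : ℝ) • fderiv ℝ U y y - (Δ U) y + convect U U y +
            gradient (pressurePotential U) y + F y = 0) →
          A ≤ |α| → Sper * (1 + |α|) ^ 2 ≤ δ →
            |α| * Real.sqrt (∫ y, gaussWeight y * ‖rotGen (U y) - fderiv ℝ U y (rotGen y)‖ ^ 2) ≤ ε := by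
  obtain ⟨A', hA'0, hA'⟩ := exists_bound_abs_pressurePotential_decay'
  obtain ⟨A, hA1, δ, hδ, h⟩ :=
    pineauVicol_prop_8_3' C₀ C₁ C₂ (A' * (C₂ * C₀ + C₁ ^ 2 + C₀ ^ 2)) 2 Cs (by norm_num) hε
  refine ⟨A, hA1, δ, hδ, ?_⟩
  intro U F α Sper hU4 hdiv h19 h21 h21' hF hSper h82 heq hAα hsmall
  have hU2 : ContDiff ℝ 2 U := hU4.of_le (by norm_num)
  have hP : ContDiff ℝ 2 (pressurePotential U) := contDiff_pressurePotential_decay hU4 h19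
  have h22 : ∀ y, |pressurePotential U y| ≤
      A' * (C₂ * C₀ + C₁ ^ 2 + C₀ ^ 2) / (1 + ‖y‖ ^ (2 : ℝ)) :=
    hA' U C₀ C₁ C₂ hU2 h19 h21 h21'
  have hPois : ∀ y, Δ (pressurePotential U) y = -VectorCalculus.divergence (convect U U) y := by
    intro y
    rw [laplacian_pressurePotential_decay hU4 h19, pressureSource_eq_of_isDivFree hdiv]
  exact h U F (pressurePotential U) α Sper hU2 hP h19 h21 h21' h22 hPois hF hSper h82 heq hAα hsmall

/-- **Pineau–Vicol 2026, Proposition 6.5 (6.20), as printed (`∃ A_ε ≥ 1`), for the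
Calderón–Zygmund pressure `P = RᵢRⱼ(UⁱUʲ)` of an RSS profile, with hypotheses on the profile only.**
As the tree's `pineauVicol_prop_6_5_exists'` (`PineauVicolPressure`) with `P := Q[U]`
(`pressurePotential U`): its pressure-decay hypothesis (2.2) is discharged by
`exists_bound_abs_pressurePotential_decay'` (exponent `2 > 3/2`) and its Poisson equation by
`laplacian_pressurePotential_decay` + `pressureSource_eq_of_isDivFree`; assumed remain the decay
(1.9), (2.1) of a `C⁴` divergence-free profile and the profile equation (1.8a) with `∇Q[U]` as its
pressure gradient. [cite: PineauVicol2026, Proposition 6.5 (6.20) (p. 22); Lemma 2.1 (2.2) (p. 9)] -/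
theorem pineauVicol_prop_6_5_exists'' (C₀ C₁ C₂ : ℝ) {ε : ℝ} (hε : 0 < ε) :
    ∃ A : ℝ, 1 ≤ A ∧
      ∀ (U : EuclideanSpace ℝ (Fin 3) → EuclideanSpace ℝ (Fin 3)) (α : ℝ),
        ContDiff ℝ 4 U → VectorCalculus.IsDivFree U →
        (∀ y, ‖U y‖ ≤ C₀ / (1 + ‖y‖)) → (∀ y, ‖fderiv ℝ U y‖ ≤ C₁ / (1 + ‖y‖ ^ 2)) →
        (∀ y, ‖fderiv ℝ (fderiv ℝ U) y‖ ≤ C₂ / (1 + ‖y‖ ^ 3)) →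
        (∀ y, α • (rotGen (U y) - fderiv ℝ U y (rotGen y)) + (1 / 2 : ℝ) • U y +
          (1 / 2 : ℝ) • fderiv ℝ U y y - (Δ U) y + convect U U y +
            gradient (pressurePotential U) y = 0) →
          A ≤ |α| →
            |α| * Real.sqrt (∫ y, gaussWeight y * ‖rotGen (U y) - fderiv ℝ U y (rotGen y)‖ ^ 2) ≤ ε := by
  obtain ⟨A', hA'0, hA'⟩ := exists_bound_abs_pressurePotential_decay'
  obtain ⟨A, hA1, h⟩ :=
    pineauVicol_prop_6_5_exists' C₀ C₁ C₂ (A' * (C₂ * C₀ + C₁ ^ 2 + C₀ ^ 2)) 2 (by norm_num) hε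
  refine ⟨A, hA1, ?_⟩
  intro U α hU4 hdiv h19 h21 h21' heq hAα
  have hU2 : ContDiff ℝ 2 U := hU4.of_le (by norm_num)
  have hP : ContDiff ℝ 2 (pressurePotential U) := contDiff_pressurePotential_decay hU4 h19
  have h22 : ∀ y, |pressurePotential U y| ≤
      A' * (C₂ * C₀ + C₁ ^ 2 + C₀ ^ 2) / (1 + ‖y‖ ^ (2 : ℝ)) :=
    hA' U C₀ C₁ C₂ hU2 h19 h21 h21'
  have hPois : ∀ y, Δ (pressurePotential U) y = -VectorCalculus.divergence (convect U U) y := by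
    intro y
    rw [laplacian_pressurePotential_decay hU4 h19, pressureSource_eq_of_isDivFree hdiv]
  exact h U (pressurePotential U) α hU2 hP h19 h21 h21' h22 hPois heq hAα

/-! ## Pointwise decay of the pressure GRADIENT (Lemma 2.1 / (8.3), `k = 1`, `σ = 0`)

The same dilation argument one derivative up: `∇(Q[λv(λ·)])(e) = λ³ (∇Q[v])(λe)`, and at the unit
vector the near part is `Γ₀ ∈ L¹` against a pointwise Leibniz bound for `∇∂ᵢ∂ⱼ(wᵢwⱼ)` on
`|e − z| ≥ 1/2` (this is where `D³v` enters), the far part the kernel `D³Γ∞` (decaying like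
`(1+|z|)⁻³`) against the weight `C₀²|y|⁻²`. -/

section GradientDecay

/-- `Σᵢ C(m,i) aᵢ bᵢ ≤ 2ᵐ B²` when `0 ≤ aᵢ ≤ B`, `0 ≤ bᵢ ≤ B` (`Σᵢ C(m,i) = 2ᵐ`). [folklore] -/
private theorem sum_choose_mul_le_sq {m : ℕ} {a b : ℕ → ℝ} {B : ℝ} (hB : 0 ≤ B)
    (hb0 : ∀ i, 0 ≤ b i)
    (ha : ∀ i ∈ Finset.range (m + 1), a i ≤ B) (hb : ∀ i ∈ Finset.range (m + 1), b i ≤ B) :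
    ∑ i ∈ Finset.range (m + 1), (m.choose i : ℝ) * a i * b i ≤ 2 ^ m * B ^ 2 := by
  have hsum : ∑ i ∈ Finset.range (m + 1), (m.choose i : ℝ) = 2 ^ m := by
    have := Nat.sum_range_choose m
    exact_mod_cast this
  calc ∑ i ∈ Finset.range (m + 1), (m.choose i : ℝ) * a i * b i
      ≤ ∑ i ∈ Finset.range (m + 1), (m.choose i : ℝ) * B * B :=
        Finset.sum_le_sum fun i hi =>
          mul_le_mul (mul_le_mul_of_nonneg_left (ha i hi) (Nat.cast_nonneg _)) (hb i hi) (hb0 i)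
            (mul_nonneg (Nat.cast_nonneg _) hB)
    _ = (∑ i ∈ Finset.range (m + 1), (m.choose i : ℝ)) * B * B := by
        rw [Finset.sum_mul, Finset.sum_mul]
    _ = 2 ^ m * B ^ 2 := by rw [hsum]; ring

/-- **Pointwise Leibniz bound for the derivatives of the quadratic source**
`G[w] = ∂ᵢ∂ⱼ(wᵢwⱼ) = div(Dw[w] + (div w) w)`: if `‖Dʲw(y)‖ ≤ B` for all `j ≤ k + 2` AT THE POINT `y`,
then `‖DᵏG[w](y)‖ ≤ 2^{k+1} B² T (1+T)`, `T = ‖tr‖` (`DᵏG = tr ∘ D^{k+1}(Dw[w] + (div w) w)`,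
`div w = tr ∘ Dw`, Mathlib's `norm_iteratedFDeriv_clm_apply` / `norm_iteratedFDeriv_smul_le`;
Literature-side twin of a Summits-side lemma which Literature cannot import). [folklore] -/
private theorem norm_iteratedFDeriv_pressureSource_le_pointwise
    {w : (EuclideanSpace ℝ (Fin 3)) → (EuclideanSpace ℝ (Fin 3))}
    (hw : ContDiff ℝ ∞ w) (k : ℕ) {B : ℝ} (hB0 : 0 ≤ B) (y : EuclideanSpace ℝ (Fin 3))
    (hB : ∀ j ≤ k + 2, ‖iteratedFDeriv ℝ j w y‖ ≤ B) :
    ‖iteratedFDeriv ℝ k (pressureSource w) y‖ ≤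
      2 ^ (k + 1) * B ^ 2 *
        (‖(traceCLM : ((EuclideanSpace ℝ (Fin 3)) →L[ℝ] (EuclideanSpace ℝ (Fin 3))) →L[ℝ] ℝ)‖ *
          (1 + ‖(traceCLM : ((EuclideanSpace ℝ (Fin 3)) →L[ℝ] (EuclideanSpace ℝ (Fin 3))) →L[ℝ] ℝ)‖)) := by
  set T : ℝ := ‖(traceCLM : ((EuclideanSpace ℝ (Fin 3)) →L[ℝ] (EuclideanSpace ℝ (Fin 3))) →L[ℝ] ℝ)‖
    with hT
  have hT0 : 0 ≤ T := norm_nonneg _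
  have hDw : ContDiff ℝ ∞ (fderiv ℝ w) := hw.fderiv_right (m := ∞) le_rfl
  have hdiv : ContDiff ℝ ∞ (VectorCalculus.divergence w) := by
    rw [divergence_eq_traceCLM_comp]; exact traceCLM.contDiff.comp hDw
  have hconv : ContDiff ℝ ∞ (convect w w) := by
    have e : convect w w = fun y => (fderiv ℝ w y) (w y) := rfl
    rw [e]; exact hDw.clm_apply hw
  have hsm : ContDiff ℝ ∞ (fun y => VectorCalculus.divergence w y • w y) := hdiv.smul hw
  set W : (EuclideanSpace ℝ (Fin 3)) → (EuclideanSpace ℝ (Fin 3)) :=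
    convect w w + fun y => VectorCalculus.divergence w y • w y with hW
  have hWs : ContDiff ℝ ∞ W := hconv.add hsm
  have hG : pressureSource w = traceCLM ∘ fderiv ℝ W := by
    rw [pressureSource_def, divergence_eq_traceCLM_comp]
    rfl
  -- derivative bounds of `w` in the needed ranges
  have hDj : ∀ i ∈ Finset.range (k + 2), ‖iteratedFDeriv ℝ i (fderiv ℝ w) y‖ ≤ B := by
    intro i hi
    rw [norm_iteratedFDeriv_fderiv]
    exact hB (i + 1) (by have := Finset.mem_range.1 hi; omega)
  have hwj : ∀ i ∈ Finset.range (k + 2), ‖iteratedFDeriv ℝ (k + 1 - i) w y‖ ≤ B := by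
    intro i hi
    exact hB (k + 1 - i) (by omega)
  have hdivj : ∀ i ∈ Finset.range (k + 2), ‖iteratedFDeriv ℝ i (VectorCalculus.divergence w) y‖ ≤ T * B := by
    intro i hi
    rw [divergence_eq_traceCLM_comp]
    calc ‖iteratedFDeriv ℝ i (traceCLM ∘ fderiv ℝ w) y‖ ≤ T * ‖iteratedFDeriv ℝ i (fderiv ℝ w) y‖ :=
          ContinuousLinearMap.norm_iteratedFDeriv_comp_left _ hDw.contDiffAt (by exact_mod_cast le_top)
      _ ≤ T * B := mul_le_mul_of_nonneg_left (hDj i hi) hT0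
  -- (a) the convective term
  have ha : ‖iteratedFDeriv ℝ (k + 1) (convect w w) y‖ ≤ 2 ^ (k + 1) * B ^ 2 := by
    have e : convect w w = fun y => (fderiv ℝ w y) (w y) := rfl
    rw [e]
    refine (norm_iteratedFDeriv_clm_apply hDw hw y (by exact_mod_cast le_top)).trans ?_
    exact sum_choose_mul_le_sq hB0 (fun _ => norm_nonneg _) hDj hwj
  -- (b) the compressible term
  have hb : ‖iteratedFDeriv ℝ (k + 1) (fun y => VectorCalculus.divergence w y • w y) y‖ ≤
      2 ^ (k + 1) * (T * B) * B := by
    refine (norm_iteratedFDeriv_smul_le hdiv hw y (by exact_mod_cast le_top)).trans ?_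
    have hTB : 0 ≤ T * B := mul_nonneg hT0 hB0
    calc ∑ i ∈ Finset.range (k + 1 + 1), ((k + 1).choose i : ℝ) *
          ‖iteratedFDeriv ℝ i (VectorCalculus.divergence w) y‖ * ‖iteratedFDeriv ℝ (k + 1 - i) w y‖
        ≤ ∑ i ∈ Finset.range (k + 1 + 1), ((k + 1).choose i : ℝ) * (T * B) * B :=
          Finset.sum_le_sum fun i hi =>
            mul_le_mul (mul_le_mul_of_nonneg_left (hdivj i hi) (Nat.cast_nonneg _)) (hwj i hi)
              (norm_nonneg _) (mul_nonneg (Nat.cast_nonneg _) hTB)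
      _ = (∑ i ∈ Finset.range (k + 1 + 1), ((k + 1).choose i : ℝ)) * (T * B) * B := by
          rw [Finset.sum_mul, Finset.sum_mul]
      _ = 2 ^ (k + 1) * (T * B) * B := by
          have hsum : ∑ i ∈ Finset.range (k + 1 + 1), ((k + 1).choose i : ℝ) = 2 ^ (k + 1) := by
            have := Nat.sum_range_choose (k + 1)
            exact_mod_cast this
          rw [hsum]
  -- assemble
  have hWk : ‖iteratedFDeriv ℝ (k + 1) W y‖ ≤ 2 ^ (k + 1) * B ^ 2 + 2 ^ (k + 1) * (T * B) * B := by
    rw [hW, iteratedFDeriv_add_apply (hconv.of_le (by exact_mod_cast le_top)).contDiffAt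
      (hsm.of_le (by exact_mod_cast le_top)).contDiffAt]
    exact (norm_add_le _ _).trans (add_le_add ha hb)
  rw [hG]
  calc ‖iteratedFDeriv ℝ k (traceCLM ∘ fderiv ℝ W) y‖ ≤ T * ‖iteratedFDeriv ℝ k (fderiv ℝ W) y‖ :=
        ContinuousLinearMap.norm_iteratedFDeriv_comp_left _
          (hWs.fderiv_right (m := ∞) le_rfl).contDiffAt (by exact_mod_cast le_top)
    _ = T * ‖iteratedFDeriv ℝ (k + 1) W y‖ := by rw [norm_iteratedFDeriv_fderiv]
    _ ≤ T * (2 ^ (k + 1) * B ^ 2 + 2 ^ (k + 1) * (T * B) * B) := mul_le_mul_of_nonneg_left hWk hT0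
    _ = 2 ^ (k + 1) * B ^ 2 * (T * (1 + T)) := by ring

/-- **Far part, unit scale, any kernel decaying like `(1+|z|)⁻³`**: for `‖Ψ z‖ ≤ M/(1+|z|)³`, a field
with `|y| |w(y)| ≤ C₀` and `|e| ≤ 1`, `∫ ‖Ψ(e − y)‖ ‖w y‖² dy ≤ M C₀² (I₂ + 8 K₅)` in the sense of an
integrable a.e. dominator (as in `exists_bound_farPotential_unitScale`). [cite: PineauVicol2026, Lemma 2.1, proof of (2.2) (p. 10)] -/
theorem exists_dominator_unitScale :
    ∃ K : ℝ, 0 ≤ K ∧ ∀ {F : Type*} [NormedAddCommGroup F] (Ψ : EuclideanSpace ℝ (Fin 3) → F) (M : ℝ),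
      0 ≤ M → (∀ z, ‖Ψ z‖ ≤ M / (1 + ‖z‖) ^ 3) →
      ∀ (w : EuclideanSpace ℝ (Fin 3) → EuclideanSpace ℝ (Fin 3)) (C₀ : ℝ),
        (∀ y, ‖w y‖ * ‖y‖ ≤ C₀) → ∀ e : EuclideanSpace ℝ (Fin 3), ‖e‖ ≤ 1 →
          ∃ g : EuclideanSpace ℝ (Fin 3) → ℝ, Integrable g ∧ ∫ y, g y ≤ K * M * C₀ ^ 2 ∧
            ∀ᵐ y : EuclideanSpace ℝ (Fin 3) ∂volume, ‖Ψ (e - y)‖ * ‖w y‖ ^ 2 ≤ g y := by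
  set I₂ : ℝ := ∫ y in ball (0 : EuclideanSpace ℝ (Fin 3)) 2, (‖y‖ ^ 2)⁻¹ with hI₂
  set K₅ : ℝ := ∫ y : EuclideanSpace ℝ (Fin 3), ((1 + ‖y‖) ^ 5)⁻¹ with hK₅
  have hI₂0 : 0 ≤ I₂ := integral_nonneg fun y => by positivity
  have hK₅0 : 0 ≤ K₅ := integral_nonneg fun y => by positivity
  refine ⟨I₂ + 8 * K₅, by positivity, ?_⟩
  intro F _ Ψ M hM0 hΨ w C₀ hw e he
  have hC0 : 0 ≤ C₀ := by simpa using hw 0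
  set g : EuclideanSpace ℝ (Fin 3) → ℝ := fun y =>
    M * C₀ ^ 2 * ((ball (0 : EuclideanSpace ℝ (Fin 3)) 2).indicator (fun y => (‖y‖ ^ 2)⁻¹) y +
      8 * ((1 + ‖y‖) ^ 5)⁻¹) with hg
  have hgi : Integrable g := by
    refine Integrable.const_mul (Integrable.add ?_ ?_) _
    · exact (integrableOn_inv_norm_sq_ball 2).integrable_indicator measurableSet_ball
    · exact (integrable_inv_one_add_norm_pow (by norm_num : 4 ≤ 5)).const_mul 8
  have hgint : ∫ y, g y = M * C₀ ^ 2 * (I₂ + 8 * K₅) := by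
    simp only [hg]
    rw [integral_const_mul, integral_add
      ((integrableOn_inv_norm_sq_ball 2).integrable_indicator measurableSet_ball)
      ((integrable_inv_one_add_norm_pow (by norm_num : 4 ≤ 5)).const_mul 8),
      integral_indicator measurableSet_ball, integral_const_mul]
  refine ⟨g, hgi, by rw [hgint]; exact le_of_eq (by ring), ?_⟩
  filter_upwards [Measure.ae_ne volume (0 : EuclideanSpace ℝ (Fin 3))] with y hy
  have hy0 : 0 < ‖y‖ := norm_pos_iff.2 hy
  have hwy : ‖w y‖ ≤ C₀ / ‖y‖ := by rw [le_div_iff₀ hy0]; exact hw y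
  have hwy2 : ‖w y‖ ^ 2 ≤ C₀ ^ 2 * (‖y‖ ^ 2)⁻¹ := by
    rw [← div_eq_mul_inv, ← div_pow]
    exact pow_le_pow_left₀ (norm_nonneg _) hwy 2
  have hker := hΨ (e - y)
  by_cases hy2 : ‖y‖ < 2
  · have hind : (ball (0 : EuclideanSpace ℝ (Fin 3)) 2).indicator
        (fun y : EuclideanSpace ℝ (Fin 3) => (‖y‖ ^ 2)⁻¹) y = (‖y‖ ^ 2)⁻¹ :=
      indicator_of_mem (mem_ball_zero_iff.2 hy2) _
    have hk1 : ‖Ψ (e - y)‖ ≤ M := by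
      refine hker.trans (div_le_self hM0 ?_)
      exact one_le_pow₀ (by linarith [norm_nonneg (e - y)])
    calc ‖Ψ (e - y)‖ * ‖w y‖ ^ 2 ≤ M * (C₀ ^ 2 * (‖y‖ ^ 2)⁻¹) :=
          mul_le_mul hk1 hwy2 (sq_nonneg _) hM0
      _ ≤ g y := by
          simp only [hg, hind]
          have : 0 ≤ M * C₀ ^ 2 * (8 * ((1 + ‖y‖) ^ 5)⁻¹) := by positivity
          nlinarith [this]
  · rw [not_lt] at hy2
    have hind : (ball (0 : EuclideanSpace ℝ (Fin 3)) 2).indicator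
        (fun y : EuclideanSpace ℝ (Fin 3) => (‖y‖ ^ 2)⁻¹) y = 0 :=
      indicator_of_notMem (by rw [mem_ball_zero_iff, not_lt]; exact hy2) _
    have hey : ‖y‖ ≤ 1 + ‖e - y‖ := by
      have := norm_sub_norm_le y e
      rw [norm_sub_rev] at this
      linarith
    have hk1 : ‖Ψ (e - y)‖ ≤ M / ‖y‖ ^ 3 := by
      refine hker.trans (div_le_div_of_nonneg_left hM0 (by positivity) ?_)
      exact pow_le_pow_left₀ (norm_nonneg _) hey 3
    have h5 : M / ‖y‖ ^ 3 * (C₀ ^ 2 * (‖y‖ ^ 2)⁻¹) = M * C₀ ^ 2 / ‖y‖ ^ 5 := by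
      field_simp
    have h6 : M * C₀ ^ 2 / ‖y‖ ^ 5 ≤ M * C₀ ^ 2 * (8 * ((1 + ‖y‖) ^ 5)⁻¹) := by
      rw [div_le_iff₀ (by positivity)]
      have hp : 0 < (1 + ‖y‖) ^ 5 := by positivity
      have : M * C₀ ^ 2 * (8 * ((1 + ‖y‖) ^ 5)⁻¹) * ‖y‖ ^ 5 =
          M * C₀ ^ 2 * ((8 * ‖y‖ ^ 5) / (1 + ‖y‖) ^ 5) := by
        field_simp
      rw [this]
      have h23 : (1 + ‖y‖) ^ 5 ≤ 8 * ‖y‖ ^ 5 := by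
        have h1 : 1 + ‖y‖ ≤ (3 / 2) * ‖y‖ := by linarith
        have h2 : (1 + ‖y‖) ^ 5 ≤ ((3 / 2) * ‖y‖) ^ 5 := pow_le_pow_left₀ (by positivity) h1 5
        nlinarith [h2, pow_nonneg hy0.le 5]
      have h7 : 1 ≤ (8 * ‖y‖ ^ 5) / (1 + ‖y‖) ^ 5 := by rw [le_div_iff₀ hp]; linarith
      have hMC : 0 ≤ M * C₀ ^ 2 := by positivity
      nlinarith [mul_le_mul_of_nonneg_left h7 hMC]
    calc ‖Ψ (e - y)‖ * ‖w y‖ ^ 2 ≤ M / ‖y‖ ^ 3 * (C₀ ^ 2 * (‖y‖ ^ 2)⁻¹) :=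
          mul_le_mul hk1 hwy2 (sq_nonneg _) (by positivity)
      _ = M * C₀ ^ 2 / ‖y‖ ^ 5 := h5
      _ ≤ M * C₀ ^ 2 * (8 * ((1 + ‖y‖) ^ 5)⁻¹) := h6
      _ = g y := by simp only [hg, hind, zero_add]

/-- **Far part of the GRADIENT, unit scale**: `‖∂ₐQ₂^{1/4,1/2}[w](e)‖ ≤ K C₀² ‖a‖` for `w` continuous
in the decay class with `|y| |w(y)| ≤ C₀` and `|e| ≤ 1` (`∂ₐQ₂ = ∫ D³Γ∞(e − y)(a, w, w)`, kernel
`‖D³Γ∞‖ ≤ M(1+|z|)⁻³` against `C₀²|y|⁻²`). [cite: PineauVicol2026, Lemma 2.1, proof of (2.2) (p. 10)] -/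
theorem exists_bound_fderiv_farPotential_unitScale :
    ∃ K : ℝ, 0 ≤ K ∧ ∀ (w : EuclideanSpace ℝ (Fin 3) → EuclideanSpace ℝ (Fin 3)) (C₀ C' : ℝ),
      Continuous w → (∀ y, ‖w y‖ ≤ C' / (1 + ‖y‖)) → (∀ y, ‖w y‖ * ‖y‖ ≤ C₀) →
      ∀ e : EuclideanSpace ℝ (Fin 3), ‖e‖ ≤ 1 → ∀ a : EuclideanSpace ℝ (Fin 3),
        ‖fderiv ℝ (farPotential (4⁻¹ * 1) (4⁻¹ * 2) w) e a‖ ≤ K * C₀ ^ 2 * ‖a‖ := by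
  have h₀ : (0 : ℝ) < 4⁻¹ * 1 := by norm_num
  have h₁ : (4⁻¹ * 1 : ℝ) < 4⁻¹ * 2 := by norm_num
  obtain ⟨⟨M₀, hM₀⟩, ⟨M₁, hM₁⟩, -⟩ := exists_hasDecay_fderiv_newtonFar h₀ h₁
  have hM₁' : ∀ z, ‖fderiv ℝ (fderiv ℝ (fderiv ℝ (newtonFar (4⁻¹ * 1) (4⁻¹ * 2)))) z‖ ≤
      M₁ / (1 + ‖z‖) ^ 3 := hasDecay_iff_div.1 hM₁
  have hM₁0 : 0 ≤ M₁ := hM₁.nonneg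
  obtain ⟨K, hK0, hK⟩ := exists_dominator_unitScale
  refine ⟨K * M₁, by positivity, ?_⟩
  intro w C₀ C' hwc hdec hw e he a
  have hL := hasDecay_two_evalDiag hdec
  have hLc : Continuous fun y => evalDiag (w y) := continuous_evalDiag.comp hwc
  rw [farPotential_eq, fderiv_integral_clm_apply_comp_sub_apply_decay
    ((contDiff_fderiv2_newtonFar h₀ h₁).of_le one_le_two) hM₀ hM₁ hLc hL e a]
  obtain ⟨g, hgi, hgint, hg⟩ := hK _ M₁ hM₁0 hM₁' w C₀ hw e he
  calc ‖∫ y, evalDiag (w y) (fderiv ℝ (fderiv ℝ (fderiv ℝ (newtonFar (4⁻¹ * 1) (4⁻¹ * 2)))) (e - y) a)‖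
      ≤ ∫ y, g y * ‖a‖ := by
        refine norm_integral_le_of_norm_le (hgi.mul_const _) ?_
        filter_upwards [hg] with y hy
        calc ‖evalDiag (w y) (fderiv ℝ (fderiv ℝ (fderiv ℝ (newtonFar (4⁻¹ * 1) (4⁻¹ * 2)))) (e - y) a)‖
            ≤ ‖evalDiag (w y)‖ *
                ‖fderiv ℝ (fderiv ℝ (fderiv ℝ (newtonFar (4⁻¹ * 1) (4⁻¹ * 2)))) (e - y) a‖ :=
              ContinuousLinearMap.le_opNorm _ _
          _ ≤ ‖w y‖ ^ 2 *
                (‖fderiv ℝ (fderiv ℝ (fderiv ℝ (newtonFar (4⁻¹ * 1) (4⁻¹ * 2)))) (e - y)‖ * ‖a‖) :=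
              mul_le_mul (norm_evalDiag_le _) (ContinuousLinearMap.le_opNorm _ _) (norm_nonneg _)
                (sq_nonneg _)
          _ = ‖fderiv ℝ (fderiv ℝ (fderiv ℝ (newtonFar (4⁻¹ * 1) (4⁻¹ * 2)))) (e - y)‖ * ‖w y‖ ^ 2 *
                ‖a‖ := by ring
          _ ≤ g y * ‖a‖ := mul_le_mul_of_nonneg_right hy (norm_nonneg _)
    _ = (∫ y, g y) * ‖a‖ := integral_mul_const _ _
    _ ≤ K * M₁ * C₀ ^ 2 * ‖a‖ := mul_le_mul_of_nonneg_right hgint (norm_nonneg _)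

/-- **Near part of the GRADIENT, unit scale**: for `w ∈ C^∞` with `|y|^{j+1} ‖Dʲw(y)‖ ≤ C`, `j ≤ 3`,
and a unit vector `e`, `‖∂ₐQ₁^{1/4,1/2}[w](e)‖ ≤ K C² ‖a‖` (`∂ₐQ₁ = ∫ Γ₀(z) ∂ₐG[w](e − z) dz`, and on
the support `|z| ≤ 1/2` one has `|e − z| ≥ 1/2`, where `‖Dʲw‖ ≤ 2^{j+1} C ≤ 16 C` and so
`‖DG[w]‖ ≤ 4 (16C)² T(1+T)`). [cite: PineauVicol2026, Lemma 2.1, proof of (2.2) (p. 10)] -/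
theorem exists_bound_fderiv_nearPotential_unitScale :
    ∃ K : ℝ, 0 ≤ K ∧ ∀ (w : EuclideanSpace ℝ (Fin 3) → EuclideanSpace ℝ (Fin 3)) (C : ℝ),
      ContDiff ℝ ∞ w → (∀ j ≤ 3, ∀ y, ‖y‖ ^ (j + 1) * ‖iteratedFDeriv ℝ j w y‖ ≤ C) →
      ∀ e : EuclideanSpace ℝ (Fin 3), ‖e‖ = 1 → ∀ a : EuclideanSpace ℝ (Fin 3),
        ‖fderiv ℝ (nearPotential (4⁻¹ * 1) (4⁻¹ * 2) w) e a‖ ≤ K * C ^ 2 * ‖a‖ := by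
  have h₀ : (0 : ℝ) ≤ 4⁻¹ * 1 := by norm_num
  have h₁ : (4⁻¹ * 1 : ℝ) < 4⁻¹ * 2 := by norm_num
  set N : ℝ := ∫ z, |newtonNear (4⁻¹ * 1) (4⁻¹ * 2) (z : EuclideanSpace ℝ (Fin 3))| with hN
  have hN0 : 0 ≤ N := integral_nonneg fun _ => abs_nonneg _
  set T : ℝ := ‖(traceCLM : ((EuclideanSpace ℝ (Fin 3)) →L[ℝ] (EuclideanSpace ℝ (Fin 3))) →L[ℝ] ℝ)‖
    with hT
  have hT0 : 0 ≤ T := norm_nonneg _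
  refine ⟨N * (1024 * (T * (1 + T))), by positivity, ?_⟩
  intro w C hw hC e he a
  have hC0 : 0 ≤ C := le_trans (by positivity) (hC 0 (by norm_num) 0)
  -- the source-gradient bound on `|y| ≥ 1/2`
  have hG : ∀ y : EuclideanSpace ℝ (Fin 3), 2⁻¹ ≤ ‖y‖ →
      ‖fderiv ℝ (pressureSource w) y‖ ≤ 1024 * (T * (1 + T)) * C ^ 2 := by
    intro y hy
    have hy0 : 0 < ‖y‖ := by linarith
    have hB : ∀ j ≤ 1 + 2, ‖iteratedFDeriv ℝ j w y‖ ≤ 16 * C := by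
      intro j hj
      have h1 := hC j (by omega) y
      have hyj : (2⁻¹ : ℝ) ^ (j + 1) ≤ ‖y‖ ^ (j + 1) := pow_le_pow_left₀ (by norm_num) hy _
      have h16 : (1 : ℝ) ≤ 16 * 2⁻¹ ^ (j + 1) := by
        interval_cases j <;> norm_num
      have hD0 := norm_nonneg (iteratedFDeriv ℝ j w y)
      calc ‖iteratedFDeriv ℝ j w y‖ = 1 * ‖iteratedFDeriv ℝ j w y‖ := (one_mul _).symm
        _ ≤ (16 * 2⁻¹ ^ (j + 1)) * ‖iteratedFDeriv ℝ j w y‖ := mul_le_mul_of_nonneg_right h16 hD0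
        _ ≤ (16 * ‖y‖ ^ (j + 1)) * ‖iteratedFDeriv ℝ j w y‖ :=
            mul_le_mul_of_nonneg_right (mul_le_mul_of_nonneg_left hyj (by norm_num)) hD0
        _ = 16 * (‖y‖ ^ (j + 1) * ‖iteratedFDeriv ℝ j w y‖) := by ring
        _ ≤ 16 * C := mul_le_mul_of_nonneg_left h1 (by norm_num)
    have h := norm_iteratedFDeriv_pressureSource_le_pointwise hw 1 (by positivity) y hB
    rw [← hT, norm_iteratedFDeriv_one] at h
    calc ‖fderiv ℝ (pressureSource w) y‖ ≤ 2 ^ (1 + 1) * (16 * C) ^ 2 * (T * (1 + T)) := h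
      _ = 1024 * (T * (1 + T)) * C ^ 2 := by ring
  -- differentiate under the integral sign
  have hG1 : ContDiff ℝ 1 (pressureSource w) :=
    contDiff_pressureSource (n := 1) (by exact_mod_cast (contDiff_infty.1 hw 3))
  have e1 : nearPotential (4⁻¹ * 1) (4⁻¹ * 2) w =
      fun x => ∫ z, newtonNear (4⁻¹ * 1) (4⁻¹ * 2) z • pressureSource w (x - z) := by
    funext x; rfl
  rw [e1, fderiv_integral_smul_comp_sub_apply (integrable_newtonNear h₀ h₁)
    (fun z hz => newtonNear_eq_zero h₀ h₁ hz.le) hG1 e a]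
  have hint : Integrable fun z => |newtonNear (4⁻¹ * 1 : ℝ) (4⁻¹ * 2) z| *
      (1024 * (T * (1 + T)) * C ^ 2 * ‖a‖) :=
    (integrable_newtonNear h₀ h₁).abs.mul_const _
  calc ‖∫ z, newtonNear (4⁻¹ * 1) (4⁻¹ * 2) z • fderiv ℝ (pressureSource w) (e - z) a‖
      ≤ ∫ z, |newtonNear (4⁻¹ * 1 : ℝ) (4⁻¹ * 2) z| * (1024 * (T * (1 + T)) * C ^ 2 * ‖a‖) := by
        refine norm_integral_le_of_norm_le hint (Eventually.of_forall fun z => ?_)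
        rw [smul_eq_mul, norm_mul, Real.norm_eq_abs]
        by_cases hz : 4⁻¹ * 2 ≤ ‖z‖
        · rw [newtonNear_eq_zero h₀ h₁ hz, abs_zero, zero_mul, zero_mul]
        · rw [not_le] at hz
          refine mul_le_mul_of_nonneg_left ?_ (abs_nonneg _)
          have hez : 2⁻¹ ≤ ‖e - z‖ := by
            have := norm_sub_norm_le e z
            rw [he] at this
            linarith
          exact (ContinuousLinearMap.le_opNorm _ _).trans
            (mul_le_mul_of_nonneg_right (hG _ hez) (norm_nonneg _))
    _ = N * (1024 * (T * (1 + T))) * C ^ 2 * ‖a‖ := by rw [integral_mul_const, hN]; ring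

/-- For the dilation `w(z) = λ v(λ z)`, `λ > 0`: `|y|^{j+1} ‖Dʲw(y)‖ ≤ C` from
`(1+|y|)^{j+1} ‖Dʲv(y)‖ ≤ C` (`Dʲw(y) = λ^{j+1} (Dʲv)(λy)`; the rescaling of the source's proof).
[cite: PineauVicol2026, Lemma 2.1, proof of (2.1) (p. 9–10)] -/
theorem pow_mul_norm_iteratedFDeriv_smul_comp_smul_le
    {v : EuclideanSpace ℝ (Fin 3) → EuclideanSpace ℝ (Fin 3)} (hv : ContDiff ℝ ∞ v) {C : ℝ} {j : ℕ}
    (hC : ∀ y, (1 + ‖y‖) ^ (j + 1) * ‖iteratedFDeriv ℝ j v y‖ ≤ C) {lam : ℝ} (hlam : 0 < lam)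
    (y : EuclideanSpace ℝ (Fin 3)) :
    ‖y‖ ^ (j + 1) * ‖iteratedFDeriv ℝ j (fun z => lam • v (lam • z)) y‖ ≤ C := by
  have hC0 : 0 ≤ C := by
    have := hC 0
    exact le_trans (by positivity) this
  -- `‖Dʲ(λ v(λ ·))(y)‖ ≤ λ^{j+1} ‖Dʲv(λ y)‖` (chain rule with the dilation `L = λ id`)
  have h : ‖iteratedFDeriv ℝ j (fun z => lam • v (lam • z)) y‖ ≤
      lam * lam ^ j * ‖iteratedFDeriv ℝ j v (lam • y)‖ := by
    set L : EuclideanSpace ℝ (Fin 3) →L[ℝ] EuclideanSpace ℝ (Fin 3) :=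
      lam • ContinuousLinearMap.id ℝ (EuclideanSpace ℝ (Fin 3)) with hL
    have hvj : ContDiff ℝ j v := hv.of_le (by exact_mod_cast le_top)
    have hvL : ContDiff ℝ j (v ∘ L) := hvj.comp L.contDiff
    have e1 : (fun z => lam • v (lam • z)) = lam • (v ∘ L) := by
      funext z; simp [hL]
    rw [e1, iteratedFDeriv_const_smul_apply (a := lam) hvL.contDiffAt, norm_smul, Real.norm_eq_abs,
      abs_of_pos hlam, L.iteratedFDeriv_comp_right hvj y le_rfl]
    have hLy : L y = lam • y := by simp [hL]
    rw [hLy, mul_assoc]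
    refine mul_le_mul_of_nonneg_left ?_ hlam.le
    refine (ContinuousMultilinearMap.norm_compContinuousLinearMap_le _ _).trans ?_
    rw [Finset.prod_const, Finset.card_univ, Fintype.card_fin, mul_comm]
    have hLn : ‖L‖ ≤ lam := by
      rw [hL, norm_smul, Real.norm_eq_abs, abs_of_pos hlam]
      calc lam * ‖ContinuousLinearMap.id ℝ (EuclideanSpace ℝ (Fin 3))‖ ≤ lam * 1 := by
            gcongr; exact ContinuousLinearMap.norm_id_le
        _ = lam := mul_one _
    exact mul_le_mul_of_nonneg_right (pow_le_pow_left₀ (norm_nonneg _) hLn j) (norm_nonneg _)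
  have h2 := hC (lam • y)
  rw [norm_smul, Real.norm_eq_abs, abs_of_pos hlam] at h2
  have hly : 0 ≤ lam * ‖y‖ := by positivity
  have hpow : (lam * ‖y‖) ^ (j + 1) ≤ (1 + lam * ‖y‖) ^ (j + 1) :=
    pow_le_pow_left₀ hly (by linarith) _
  have hD0 := norm_nonneg (iteratedFDeriv ℝ j v (lam • y))
  calc ‖y‖ ^ (j + 1) * ‖iteratedFDeriv ℝ j (fun z => lam • v (lam • z)) y‖
      ≤ ‖y‖ ^ (j + 1) * (lam * lam ^ j * ‖iteratedFDeriv ℝ j v (lam • y)‖) :=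
        mul_le_mul_of_nonneg_left h (by positivity)
    _ = (lam * ‖y‖) ^ (j + 1) * ‖iteratedFDeriv ℝ j v (lam • y)‖ := by ring
    _ ≤ (1 + lam * ‖y‖) ^ (j + 1) * ‖iteratedFDeriv ℝ j v (lam • y)‖ :=
        mul_le_mul_of_nonneg_right hpow hD0
    _ ≤ C := h2

/-- **A uniform bound for the pressure GRADIENT** on the decay class: `‖∇Q[v](x)‖ ≤ K C²` for
`|x| ≤ 1` when `(1+|y|)^{j+1}‖Dʲv(y)‖ ≤ C`, `j ≤ 3` (the tree's `exists_bound_fderiv_pressurePotential`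
with the source-gradient bound `‖∇∂ᵢ∂ⱼ(vᵢvⱼ)‖ ≤ 4C²T(1+T)`). [cite: PineauVicol2026, Lemma 2.1, proof of (2.2) (p. 10)] -/
theorem exists_bound_fderiv_pressurePotential_of_decay :
    ∃ K : ℝ, 0 ≤ K ∧ ∀ (v : EuclideanSpace ℝ (Fin 3) → EuclideanSpace ℝ (Fin 3)) (C : ℝ),
      ContDiff ℝ ∞ v → (∀ j ≤ 3, ∀ y, (1 + ‖y‖) ^ (j + 1) * ‖iteratedFDeriv ℝ j v y‖ ≤ C) →
      ∀ x : EuclideanSpace ℝ (Fin 3), ‖x‖ ≤ 1 → ‖fderiv ℝ (pressurePotential v) x‖ ≤ K * C ^ 2 := by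
  obtain ⟨K, hK0, hK⟩ := exists_bound_fderiv_pressurePotential
  set T : ℝ := ‖(traceCLM : ((EuclideanSpace ℝ (Fin 3)) →L[ℝ] (EuclideanSpace ℝ (Fin 3))) →L[ℝ] ℝ)‖
    with hT
  have hT0 : 0 ≤ T := norm_nonneg _
  refine ⟨K * (4 * (T * (1 + T)) + 27), by positivity, ?_⟩
  intro v C hv hC x hx
  have hC0 : 0 ≤ C := le_trans (by positivity) (hC 0 (by norm_num) 0)
  have hdec : ∀ y, ‖v y‖ ≤ C / (1 + ‖y‖) := by
    intro y
    have h := hC 0 (by norm_num) y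
    rw [norm_iteratedFDeriv_zero, zero_add, pow_one] at h
    rw [le_div_iff₀ (by positivity)]
    linarith
  have hB : ∀ y, ‖fderiv ℝ (pressureSource v) y‖ ≤ 4 * (T * (1 + T)) * C ^ 2 := by
    intro y
    have hBj : ∀ j ≤ 1 + 2, ‖iteratedFDeriv ℝ j v y‖ ≤ C := by
      intro j hj
      have h := hC j (by omega) y
      have h1 : 1 ≤ (1 + ‖y‖) ^ (j + 1) := one_le_pow₀ (by linarith [norm_nonneg y])
      have hD0 := norm_nonneg (iteratedFDeriv ℝ j v y)
      nlinarith [mul_le_mul_of_nonneg_right h1 hD0]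
    have h := norm_iteratedFDeriv_pressureSource_le_pointwise hv 1 hC0 y hBj
    rw [← hT, norm_iteratedFDeriv_one] at h
    calc ‖fderiv ℝ (pressureSource v) y‖ ≤ 2 ^ (1 + 1) * C ^ 2 * (T * (1 + T)) := h
      _ = 4 * (T * (1 + T)) * C ^ 2 := by ring
  have h := hK v C (4 * (T * (1 + T)) * C ^ 2) (contDiff_infty.1 hv 3) hdec
    (by positivity) hB x
  have h27 : (2 + ‖x‖) ^ 3 ≤ 27 := by
    have := pow_le_pow_left₀ (by positivity : (0 : ℝ) ≤ 2 + ‖x‖) (by linarith : 2 + ‖x‖ ≤ 3) 3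
    linarith [this]
  calc ‖fderiv ℝ (pressurePotential v) x‖ ≤ K * (4 * (T * (1 + T)) * C ^ 2 + C ^ 2 * (2 + ‖x‖) ^ 3) := h
    _ ≤ K * (4 * (T * (1 + T)) * C ^ 2 + C ^ 2 * 27) := by
        gcongr
    _ = K * (4 * (T * (1 + T)) + 27) * C ^ 2 := by ring

/-- **Pineau–Vicol 2026, Lemma 2.1 / (8.3), `k = 1`, `σ = 0` — pointwise decay of the pressure
GRADIENT on the decay class.** There is an absolute `A` such that for `v ∈ C^∞(ℝ³)` with
`(1+|y|)^{j+1} ‖Dʲv(y)‖ ≤ C` for `j ≤ 3` (the Type I decay (1.9), (2.1) up to third order), the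
Calderón–Zygmund pressure satisfies `‖∇Q[v](x)‖ ≤ A C² (1+|x|)⁻³` for all `x` — the `k = 1` case of
the printed `|∇ᵏP(y)| ≤ C_{P,k}/(1+|y|)^{2−σ+k}` ((8.3); Lemma 2.1 for `k = 0`), with `σ = 0`. Same
dilation argument as `exists_bound_abs_pressurePotential_decay`, one derivative up:
`∇(Q[λv(λ·)])(e) = λ³(∇Q[v])(λe)`. [cite: PineauVicol2026, Lemma 8.1 (8.3) (p. 28); Lemma 2.1 (2.2) (p. 9), proof p. 10] -/
theorem exists_bound_norm_fderiv_pressurePotential_decay :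
    ∃ A : ℝ, 0 ≤ A ∧ ∀ (v : EuclideanSpace ℝ (Fin 3) → EuclideanSpace ℝ (Fin 3)) (C : ℝ),
      ContDiff ℝ ∞ v → (∀ j ≤ 3, ∀ y, (1 + ‖y‖) ^ (j + 1) * ‖iteratedFDeriv ℝ j v y‖ ≤ C) →
      ∀ x, ‖fderiv ℝ (pressurePotential v) x‖ ≤ A * C ^ 2 / (1 + ‖x‖) ^ 3 := by
  obtain ⟨Kn, hKn0, hKn⟩ := exists_bound_fderiv_nearPotential_unitScale
  obtain ⟨Kf, hKf0, hKf⟩ := exists_bound_fderiv_farPotential_unitScale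
  obtain ⟨Kg, hKg0, hKg⟩ := exists_bound_fderiv_pressurePotential_of_decay
  refine ⟨8 * (Kn + Kf + Kg), by positivity, ?_⟩
  intro v C hv hC x
  have hC0 : 0 ≤ C := le_trans (by positivity) (hC 0 (by norm_num) 0)
  have hdec : ∀ y, ‖v y‖ ≤ C / (1 + ‖y‖) := by
    intro y
    have h := hC 0 (by norm_num) y
    rw [norm_iteratedFDeriv_zero, zero_add, pow_one] at h
    rw [le_div_iff₀ (by positivity)]
    linarith
  have hpos : 0 < (1 + ‖x‖) ^ 3 := by positivity
  rw [le_div_iff₀ hpos]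
  by_cases hx : ‖x‖ ≤ 1
  · have h := hKg v C hv hC x hx
    have h8 : (1 + ‖x‖) ^ 3 ≤ 8 := by
      have := pow_le_pow_left₀ (by positivity : (0 : ℝ) ≤ 1 + ‖x‖) (by linarith : 1 + ‖x‖ ≤ 2) 3
      linarith [this]
    calc ‖fderiv ℝ (pressurePotential v) x‖ * (1 + ‖x‖) ^ 3 ≤ Kg * C ^ 2 * 8 :=
          mul_le_mul h h8 hpos.le (by positivity)
      _ ≤ 8 * (Kn + Kf + Kg) * C ^ 2 := by nlinarith [mul_nonneg (add_nonneg hKn0 hKf0) (sq_nonneg C)]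
  · rw [not_le] at hx
    have hlam : 0 < ‖x‖ := by linarith
    have he : ‖‖x‖⁻¹ • x‖ = 1 := by
      rw [norm_smul, norm_inv, norm_norm, inv_mul_cancel₀ hlam.ne']
    have hxe : ‖x‖ • (‖x‖⁻¹ • x) = x := by
      rw [smul_smul, mul_inv_cancel₀ hlam.ne', one_smul]
    -- the dilated field
    have hw : ContDiff ℝ ∞ (fun z => ‖x‖ • v (‖x‖ • z)) :=
      (hv.comp (contDiff_id.const_smul ‖x‖)).const_smul ‖x‖
    have hv2 : ContDiff ℝ 2 v := contDiff_infty.1 hv 2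
    have hwdec := norm_smul_comp_smul_le_decay hdec hlam
    have hw0 := norm_smul_comp_smul_mul_norm_le hdec hlam
    have hwC : ∀ j ≤ 3, ∀ y, ‖y‖ ^ (j + 1) *
        ‖iteratedFDeriv ℝ j (fun z => ‖x‖ • v (‖x‖ • z)) y‖ ≤ C :=
      fun j hj y => pow_mul_norm_iteratedFDeriv_smul_comp_smul_le hv (hC j hj) hlam y
    -- dilation covariance, differentiated
    have hQ : pressurePotential (fun z => ‖x‖ • v (‖x‖ • z)) =
        fun y => (‖x‖ ^ 2) • pressurePotential v (‖x‖ • y) := by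
      funext y
      rw [pressurePotential_smul_comp_smul hv2 hdec hlam y, smul_eq_mul]
    have hDQ : fderiv ℝ (pressurePotential (fun z => ‖x‖ • v (‖x‖ • z))) (‖x‖⁻¹ • x) =
        (‖x‖ ^ 2 * ‖x‖) • fderiv ℝ (pressurePotential v) x := by
      rw [hQ, fderiv_const_smul_comp_smul (pressurePotential v) (‖x‖ ^ 2) hlam.ne']
      dsimp only
      rw [hxe]
    -- the split at scale `1/4`, differentiated
    have h₀' : (0 : ℝ) < 4⁻¹ * 1 := by norm_num
    have h₁' : (4⁻¹ * 1 : ℝ) < 4⁻¹ * 2 := by norm_num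
    have hsplit : pressurePotential (fun z => ‖x‖ • v (‖x‖ • z)) =
        fun y => -nearPotential (4⁻¹ * 1) (4⁻¹ * 2) (fun z => ‖x‖ • v (‖x‖ • z)) y -
          farPotential (4⁻¹ * 1) (4⁻¹ * 2) (fun z => ‖x‖ • v (‖x‖ • z)) y := by
      funext y
      exact pressurePotential_eq_scale_decay (R := 4⁻¹) (by norm_num) (contDiff_infty.1 hw 2)
        hwdec y
    have hn1 : ContDiff ℝ 1 (nearPotential (4⁻¹ * 1) (4⁻¹ * 2) (fun z => ‖x‖ • v (‖x‖ • z))) :=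
      contDiff_nearPotential h₀'.le h₁' 1 (by exact_mod_cast (contDiff_infty.1 hw 3))
    have hf1 : ContDiff ℝ 1 (farPotential (4⁻¹ * 1) (4⁻¹ * 2) (fun z => ‖x‖ • v (‖x‖ • z))) :=
      (contDiff_farPotential_decay h₀' h₁' hw.continuous hwdec).1.of_le one_le_two
    have hdn := (hn1.differentiable one_ne_zero) (‖x‖⁻¹ • x)
    have hdf := (hf1.differentiable one_ne_zero) (‖x‖⁻¹ • x)
    have efd : fderiv ℝ (pressurePotential (fun z => ‖x‖ • v (‖x‖ • z))) (‖x‖⁻¹ • x) =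
        -fderiv ℝ (nearPotential (4⁻¹ * 1) (4⁻¹ * 2) (fun z => ‖x‖ • v (‖x‖ • z))) (‖x‖⁻¹ • x) -
          fderiv ℝ (farPotential (4⁻¹ * 1) (4⁻¹ * 2) (fun z => ‖x‖ • v (‖x‖ • z))) (‖x‖⁻¹ • x) := by
      rw [hsplit]
      exact (hdn.hasFDerivAt.neg.sub hdf.hasFDerivAt).fderiv
    -- the bound at the unit vector
    have hQw : ‖fderiv ℝ (pressurePotential (fun z => ‖x‖ • v (‖x‖ • z))) (‖x‖⁻¹ • x)‖ ≤
        (Kn + Kf) * C ^ 2 := by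
      rw [efd]
      refine ContinuousLinearMap.opNorm_le_bound _ (by positivity) fun a => ?_
      have hn := hKn _ C hw hwC _ he a
      have hf := hKf _ C _ hw.continuous hwdec hw0 _ he.le a
      show ‖-(fderiv ℝ (nearPotential (4⁻¹ * 1) (4⁻¹ * 2) (fun z => ‖x‖ • v (‖x‖ • z))) (‖x‖⁻¹ • x) a) -
          fderiv ℝ (farPotential (4⁻¹ * 1) (4⁻¹ * 2) (fun z => ‖x‖ • v (‖x‖ • z))) (‖x‖⁻¹ • x) a‖ ≤ _
      calc ‖-(fderiv ℝ (nearPotential (4⁻¹ * 1) (4⁻¹ * 2) (fun z => ‖x‖ • v (‖x‖ • z))) (‖x‖⁻¹ • x) a) -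
              fderiv ℝ (farPotential (4⁻¹ * 1) (4⁻¹ * 2) (fun z => ‖x‖ • v (‖x‖ • z))) (‖x‖⁻¹ • x) a‖
          ≤ ‖fderiv ℝ (nearPotential (4⁻¹ * 1) (4⁻¹ * 2) (fun z => ‖x‖ • v (‖x‖ • z))) (‖x‖⁻¹ • x) a‖ +
              ‖fderiv ℝ (farPotential (4⁻¹ * 1) (4⁻¹ * 2) (fun z => ‖x‖ • v (‖x‖ • z))) (‖x‖⁻¹ • x) a‖ := by
            rw [← norm_neg
              (fderiv ℝ (nearPotential (4⁻¹ * 1) (4⁻¹ * 2) (fun z => ‖x‖ • v (‖x‖ • z))) (‖x‖⁻¹ • x) a)]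
            exact norm_sub_le _ _
        _ ≤ Kn * C ^ 2 * ‖a‖ + Kf * C ^ 2 * ‖a‖ := add_le_add hn hf
        _ = (Kn + Kf) * C ^ 2 * ‖a‖ := by ring
    -- undo the dilation
    have hQv : ‖fderiv ℝ (pressurePotential v) x‖ * ‖x‖ ^ 3 =
        ‖fderiv ℝ (pressurePotential (fun z => ‖x‖ • v (‖x‖ • z))) (‖x‖⁻¹ • x)‖ := by
      rw [hDQ, norm_smul, Real.norm_eq_abs, abs_of_pos (by positivity), mul_comm]
      ring
    have h8 : (1 + ‖x‖) ^ 3 ≤ 8 * ‖x‖ ^ 3 := by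
      have := pow_le_pow_left₀ (by positivity : (0:ℝ) ≤ 1 + ‖x‖) (by linarith : 1 + ‖x‖ ≤ 2 * ‖x‖) 3
      linarith [this, mul_pow (2:ℝ) ‖x‖ 3]
    calc ‖fderiv ℝ (pressurePotential v) x‖ * (1 + ‖x‖) ^ 3
        ≤ ‖fderiv ℝ (pressurePotential v) x‖ * (8 * ‖x‖ ^ 3) := mul_le_mul_of_nonneg_left h8 (norm_nonneg _)
      _ = 8 * (‖fderiv ℝ (pressurePotential v) x‖ * ‖x‖ ^ 3) := by ring
      _ ≤ 8 * ((Kn + Kf) * C ^ 2) := by rw [hQv]; exact mul_le_mul_of_nonneg_left hQw (by norm_num)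
      _ ≤ 8 * (Kn + Kf + Kg) * C ^ 2 := by nlinarith [mul_nonneg hKg0 (sq_nonneg C)]

end GradientDecay

end PineauVicol2026

end Literature.Analysis.FluidPDE
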